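import Mathlib
import Literature.RepresentationTheory.HarrisKudlaSweet1996.Splittings
import Literature.NumberTheory.Automorphic.Liu2021.Def45AsPrinted
import HarnessLib

/-!
# Bergeron–Millson–Moeglin (2016) §3.3–3.6, §3.11–3.13 and §1.5: the complex structure `J_𝔭 = Ad(a(ζ))` on `𝔭`,
# `𝔭′ = V_+ ⊗ V_-^* = Hom(V_-, V_+)` = the holomorphic tangent space, and the HODGE-TYPE LABEL «type `(a, b)`» —
# the sign convention under which [Liu 2021] App. D labels `π^{1,0}_{n−1,1}`, `π^{0,1}_{n−1,1}`; with the [HKS 1996]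
# «`χ(det)`» token (1.31).  DEFINITIONS (with bodies) + their unfoldings; the packaged convention `D_BMM` is INHABITED.

Topic `RepresentationTheory/BergeronMillsonMoeglin2016`, namespace `Literature.RepresentationTheory.BergeronMillsonMoeglin2016`
(concrete objects in the sub-namespace `HodgeTypeSign`).  Companion of `CohomologicalRepresentationsUpq` (§3.2) and
`ThetaStableParabolicsUpq` (§3.7–3.8) in this directory, and of `Literature.RepresentationTheory.BorelWallach2000.UpqHodgeBigrading`
/ `BallQuotientHodgeBidegree` (Borel–Wallach II 4.1–4.2: `J = ad z₀`, `𝔭⁺` = the upper-right block — the SAME convention, §R2 there).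

## Sources, AS PRINTED (every clause below carries its locator; `pNNNN Lk` = held TeX chunk and line of `paper:arxiv-1306.1515`,
## the arXiv version of [BergeronMillsonMoeglin2016Balls]; CONCORDANCE journal ↔ arXiv: journal §(k+1) = arXiv Part 1 §k
## (k = 1,…,4: §3 = «Cohomological unitary representations», §5 = «The special (𝔲(p,q),K)-cocycles ψ_{bq,aq}»), journal §(k+5) =
## Part 2 §k, journal §(k+9) = Part 3 §k — the concordance of `CohomologicalRepresentationsUpq` / `ThetaLiftExhaustion` in this
## directory; [Liu2021]'s «[BMM]*{Section 5}» and «[BMM]*{5.7}» are therefore journal §5 = arXiv Part 1 §4 (chunks p0022–p0027),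
## §5.7 = p0027 L43–L49, quoted below next to §3.11–3.13 which carry the same weights)

N. Bergeron, J. Millson, C. Moeglin, *The Hodge conjecture and arithmetic quotients of complex balls*, Acta Math. **216** (2016)
1–125 [BergeronMillsonMoeglin2016Balls]; `G = U(p,q)`, `K = U(p) × U(q)`, `V = V_+ ⊕ V_-`, `V_+ = ℂ^p`, `V_- = ℂ^q`, `m = p + q`.
* §1.5 [p0004 L50–L59]: «The symmetric space `X` being of Hermitian type, there is an element `c` belonging to the center of
  `U(p) × U(q)` such that `Ad(c)` induces (on the tangent space `𝔭₀` of `X` associated to the class of the identity in `U(p,q)`)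
  multiplication by `i = √−1`. Let `𝔤 = 𝔨 ⊕ 𝔭′ ⊕ 𝔭″` be the associated decomposition of `𝔤 = 𝔤𝔩_{p+q}(ℂ)` – the complexification of
  `𝔲(p,q)`. Thus `𝔭′ = {X ∈ 𝔭 : Ad(c) X = iX}` (where `𝔭` is the complexification of `𝔭₀`) is the holomorphic tangent space.  As a
  representation of `GL(p,ℂ) × GL(q,ℂ)` the space `𝔭′` is isomorphic to `V_+ ⊗ V_-^*` where `V_+ = ℂ^p` (resp. `V_- = ℂ^q`) is the
  standard representation of `GL(p,ℂ)` (resp. `GL(q,ℂ)`).»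
* §3.3 [p0010 L59–L77]: «`𝔤 ≅ End(V)` … `𝔤 = V ⊗ V^* = (V_+ ⊗ V_+^*) ⊕ (V_+ ⊗ V_-^*) ⊕ (V_- ⊗ V_+^*) ⊕ (V_- ⊗ V_-^*)`»,
  «`𝔨 = (V_+ ⊗ V_+^*) ⊕ (V_- ⊗ V_-^*)`, `𝔭 = (V_+ ⊗ V_-^*) ⊕ (V_- ⊗ V_+^*)`».
* §3.4 [p0010 L81–L92, p0011 L1–L5]: «a basis `{v_i : 1 ≤ i ≤ m}` for `V` adapted to the decomposition `V = V_+ + V_-` … “early”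
  Greek letters `α` and `β` to index basis vectors … belonging to `V_+` and “late” Greek letters `μ` and `ν` … belonging to `V_-`.
  We furthermore suppose that `(v_α, v_β) = δ_{α,β}` and `(v_μ, v_ν) = −δ_{μ,ν}`. Then the matrix of the Hermitian form `( , )` on `V`
  w.r.t. to the basis `{v_i}` is the diagonal matrix `(1_p 0; 0 −1_q)` … a `m` by `m` complex matrix `(A B; C D)` belongs to `𝔤₀` if
  and only if `A^* = −A`, `D^* = −D` and `B^* = C`», «`𝔭₀ = (0 B; B^* 0)`», «`𝔭 = (0 B; C 0)` with `B`, resp. `C`, an arbitrary `p` by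
  `q`, resp. `q` by `p`, complex matrix».
* §3.5 [p0011 L9–L22]: «For `v ∈ V` we define `v^* ∈ V^*` by `v^*(u) = (u, v)` and `v₁ ⊗ v₂^* ∈ V ⊗ V^* = End(V) ≅ 𝔤` by
  `(v₁ ⊗ v₂^*)(v) = (v, v₂) v₁`.»  [p0011 L49–L62]: «We now describe the `Ad(K)`-invariant almost complex structure `J_𝔭` acting
  on `𝔭` that induces the structure of Hermitian symmetric space on `U(p,q)/(U(p) × U(q))`. Let `ζ = e^{iπ/4}`. Then `ζ` satisfies
  `ζ² = i`. Let `a(ζ)` be the diagonal `m` by `m` block matrix given by `a(ζ) = (ζ 0; 0 ζ⁻¹)`. Then `a(ζ)` is in the center of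
  `U(p) × U(q)` and the adjoint action `Ad(a(ζ))` of on `𝔭` induces the required almost complex structure, that is we have
  `J_𝔭 = Ad(a(ζ))`.»  [p0011 L67]: «`a(ζ) v_α = ζ v_α`, `a(ζ) v_μ = ζ⁻¹ v_μ`, `a(ζ) v_α^* = ζ⁻¹ v_α^*` and `a(ζ) v_μ^* = ζ v_μ^*`.»
* §3.6 [p0011 L76–L101]: «We define elements `x_{α,μ}` in `𝔭′` and `y_{α,μ}` in `𝔭″` in `𝔤` by
  `x_{α,μ} = −v_α ⊗ v_μ^* = (0 1; 0 0)` whence `J_𝔭 x_{α,μ} = i x_{α,μ}`,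
  `y_{α,μ} = σ₀(x_{α,μ}) = v_μ ⊗ v_α^* = (0 0; 1 0)` whence `J_𝔭 y_{α,μ} = −i y_{α,μ}`.
  The set `{x_{α,μ} : 1 ≤ α ≤ p, p+1 ≤ μ ≤ p+q}` is a basis for `𝔭′`. In the corresponding matrix realization we have
  `𝔭′ = V_+ ⊗ V_-^* = {(0 B; 0 0) : B ∈ M_{p×q}(ℂ)}`.  Similarly, the set `{y_{α,μ}}` is a basis for `𝔭″` and we have
  `𝔭″ = V_- ⊗ V_+^* = {(0 0; C 0) : C ∈ M_{q×p}(ℂ)}`.  Hence we have `σ₀(𝔭′) = 𝔭″`. … we have isomorphisms of `K = U(p) × U(q)`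
  modules `𝔭′ ≅ M_{p×q}(ℂ)` and `𝔭″ ≅ M_{q×p}(ℂ)` … and the above splitting into `B, C` blocks corresponds to the splitting
  `𝔭 = 𝔭′ + 𝔭″`.»
* §3.7 [p0012 L35–L37]: «We may take `i𝔱₀` as the algebra of diagonal matrices `(t_1, …, t_{p+q})`.  The roots of `𝔱` occuring in
  `𝔭′` are the linear forms `t_α − t_μ`.»
* §3.11–3.13, the NAMES of the types [p0013 L24]: «We first define the theta-stable parabolics `Q_{b,0}` which will be related to
  the cohomology of type `(bq, 0)`», [p0013 L39] «`𝔲_{b,0} ∩ 𝔭 ≅ E_b ⊗ V_-^* ⊂ 𝔭′`», [p0013 L55] «The vector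
  `e(bq,0) ∈ ∧^{bq,0}(𝔭) ≅ ∧^{bq}(𝔭′)`», [p0013 L69–L71] «the representation `V(b×q) ≅ S_{b×q}(ℂ^p) ⊗ (∧^q(ℂ^q))^{−b}` has highest
  weight `(q,…,q (b), 0,…,0 (p−b); −b,…,−b (q))`», [p0013 L88–L91] «`𝔲_{0,a} ∩ 𝔭 ≅ V_- ⊗ F_a^* ⊂ 𝔭″` … the Vogan-Zuckerman vector
  `e(0,aq) ∈ ∧^{0,aq}(𝔭) = ∧^{aq}(𝔭″)`», [p0014 L2–L4] «… has highest weight `(0,…,0 (p−a), −q,…,−q (a); a,…,a (q))`»,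
  [p0014 L41] «the Vogan-Zuckerman vector `e(bq,aq) ∈ ∧^{bq,aq} 𝔭 ≅ (∧^{bq} 𝔭′) ⊗ (∧^{aq} 𝔭″)`» (print: `(∧^{bq}𝔭′) ⊗ (∧^{aq}𝔭′)`,
  corrected by its own next line L44 «`∈ ∧^{bq}(V_+ ⊗ V_-^*) ⊗ ∧^{aq}(V_- ⊗ V_+^*)`»), [p0014 L47–L48] «the Cartan product … has highest
  weight `(q,…,q (b), 0,…,0, −q,…,−q (a); a−b,…,a−b (q))`».  §5.2.1 «A restriction on Hodge types», Remark [p0022 L97–L98]: «If we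
  insist on the standard convention `W_+ = ℂ^a` and `W_- = ℂ^b` (as we are going to do) then the Hodge degrees of the special cocycles we
  will construct will be of the form `(bq, aq)`»; §5.7 [p0027 L43–L49] (= [Liu2021]'s «[BMM]*{5.7}»): «We recall that `V(bq,aq)` is the
  representation of `U(p) × U(q)` with highest weight the sum of the two previous highest weights:
  `(q,q,⋯,q (b), 0,0,⋯,0, −q,−q,⋯,−q (a); a−b,a−b,⋯,a−b (q))`. We also note that this representation is the Cartan product of
  `S_{b×q}(ℂ^p) ⊗ det_{U(q)}^{−b}` and `S_{a×q}((ℂ^p)^*) ⊗ det_{U(q)}^{a}`».  So: type `(a, b)` ↔ `∧^a 𝔭′ ⊗ ∧^b 𝔭″ ⊂ ∧^{a+b} 𝔭`; in DEGREE ONE the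
  type-`(1,0)` summand of `∧¹𝔭 = 𝔭` is `𝔭′` (the `+i`-eigenspace of `J_𝔭`) and the type-`(0,1)` summand is `𝔭″` (the `−i`-eigenspace);
  at `(p, q) = (n−1, 1)`, `a + b = 1`: type `(1,0)` ↔ the `K`-type `V(1×1, 0) = 𝔭′ ≅ V_+ ⊗ V_-^*` of highest weight `(1,0,…,0; −1)`,
  type `(0,1)` ↔ `V(0, 1×1) = 𝔭″` of highest weight `(0,…,0,−1; 1)`.
* §6.3 (= arXiv Part 2 §1.3) [p0030 L10–L12]: «The symmetric space `X` … is also the space `X = U(p,q)/(U(p) × U(q))` of negative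
  `q`-planes in `V_{τ₁}`. It is isomorphic to a bounded symmetric domain in `ℂ^{pq}`», [p0030 L19] «a base point `x₀ ∈ X`; it
  corresponds to … a negative `q`-plane `V_-` … let `V_+ ⊂ V` denote the orthogonal complement of `V_-`», [p0030 L37] «`h₁(z)` acts by
  `z`, resp. `z̄`, on `V_+`, resp. `V_-`».  TAUTOLOGICAL CHART [folklore]: near `V_-` the `q`-planes are the graphs
  `{(Tw, w) : w ∈ V_-}` of `T ∈ Hom(V_-, V_+) = M_{p×q}(ℂ)` (the holomorphic chart of the Grassmannian; for `q = 1` the affine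
  coordinates of the unit ball), and the real tangent vector `X = (0 B; B^* 0) ∈ 𝔭₀` moves `w ∈ V_-` to `(Bw, w) + O(t²)` to first
  order, i.e. its image in `T_{V_-} X = Hom(V_-, V_+)` is its upper-right block `B` = the `V_+`-component of `X|_{V_-}` (`tautChart`,
  `tautChart_mulVec`); under this identification `J_𝔭` is multiplication by `+i` (`tautChart_Jp`), while the conjugate chart
  `X ↦ C` (= `B^*`) sees `−i` (`conjChart_Jp`).  THIS is the hinge: [BMM]'s `(1,0)` = `𝔭′` = `Hom(V_-, V_+)` = the `+i`-eigenspace is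
  the TAUTOLOGICAL holomorphic structure of the ball of negative lines, not its conjugate (pub-hodgecm2 falsifier check «BMM SIGN: C»,
  23:14Z 2026-08-23; cite-1 g81/g86/g88).

Y. Liu, *Fourier–Jacobi cycles and arithmetic relative trace formula*, Camb. J. Math. **9** (2021) = arXiv:2102.11518 [Liu2021]; TeX
source `FJcycle.tex` (md5 `6db49a74122d…`, the file read by `Literature.NumberTheory.Automorphic.Liu2021.Thm418AsPrinted`):
* §4.1 l. 1908–1912: «for every `τ ∈ Φ_F`, the component `μ_τ : (E ⊗_{F,τ} ℝ)^× → ℂ^×` is the character `z ↦ arg(z)^{−𝔴_τ}`, where we have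
  identified `(E ⊗_{F,τ} ℝ)^×` with `ℂ^×` via the unique element `τ' ∈ Φ_μ` above `τ`»; l. 1926 «`μ^{alg} := μ · |·|_E^{−1/2}`».
* Def. 4.5 (2), l. 1944–1955: «a quadruple `D_μ = (A_μ, i_μ, λ_μ, r_μ)`, in which • `A_μ` is an abelian variety over `E`, • `i_μ : M_μ →
  End_E(A_μ)_ℚ` is a CM structure such that – for every `x ∈ M_μ`, the determinant of the action of `i_μ(x)` on the `E`-vector space
  `Lie_E(A_μ)` equals `η_μ(x)`, – the associated CM character of `A_μ` with respect to the inclusion `M_μ ↪ ℂ` coincides with `μ^{alg}`,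
  • `λ_μ : A_μ → A_μ^∨` is a polarization satisfying `λ ∘ i_μ(x) = i_μ(x̄)^∨ ∘ λ` for every `x ∈ M_μ`» — TRANSCRIBED IN THE TREE as
  `Literature.NumberTheory.Automorphic.Liu2021.Def45.CMDatum` (fields `det45` = the `Lie_E(A_μ)` bullet, i.e. the Hodge type of the CM
  datum: `Lie_E(A_μ)` has determinant character `η_μ` = the type norm of the type induced from the reflex type `Ψ_μ` of `Φ_μ`,
  `Def45.apply_eta_eq_finprod`; `isCMCharacter`; `polDR` = the polarisation bullet), file `Liu2021/Def45AsPrinted.lean` — cited by name here,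
  NOT re-vendored.
* App. D, l. 5265–5276: «Now we take `F = ℝ` and `E = ℂ`. Let `(p, q)` be the signature of `V`. Then we may identify `U(V)` with `U(p,q)_ℝ`,
  the subgroup of `Res_{ℂ/ℝ} GL_n` of elements preserving the hermitian form given by the matrix `(I_p 0; 0 −I_q)` … By the computation in
  [BMM]*{Section 5}, up to equivalence, there are only two irreducible unitary representations `π` of `U(n−1,1)_ℝ` such that
  `H¹(𝔲_{n−1,1}, K_{n−1,1}; π) ≠ {0}`, in which case the cohomology has dimension `1` for both representations. Let us label them by
  `π^{1,0}_{n−1,1}` and `π^{0,1}_{n−1,1}` in the way that `H¹(𝔲_{n−1,1}, K_{n−1,1}; π^{1,0}_{n−1,1})` and `H¹(𝔲_{n−1,1}, K_{n−1,1}; π^{0,1}_{n−1,1})`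
  have Hodge types `(1, 0)` and `(0, 1)`, respectively.» («Hodge type» in the sense of [BMM16]: the cited «Section 5» is journal §5 =
  arXiv Part 1 §4, whose cocycles `ψ_{bq,aq}` have «Hodge degrees … of the form `(bq, aq)`», p0022 L97–L98.)  Lem. D.2 (2), l. 5284: «If `n ≥ 3`, then in the set `{ω^{m,±,l}_{n−1,1}}`, only
  `ω^{−1,−,0}_{n−1,1}` (resp. `ω^{1,+,0}_{n−1,1}`) is isomorphic to `π^{1,0}_{n−1,1}` (resp. `π^{0,1}_{n−1,1}`)» (proof l. 5293: «Comparing the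
  formula for the highest weights in [BMM]*{5.7} with `p = n−1, q = 1, a + b = 1 (≤ p)` with [KK07]*{Theorem 5.4}») — CITED, not transcribed.
* App. D, proof of Thm. D.6 (1), l. 5628–5630: «If `m_cusp(π_∞^{(1,0)} ⊗ π^∞) = 1`, then `H¹_B(X, ℂ)[π^∞]` has Hodge type `(1, 0)`. Thus, `μ̃` is
  the associated CM character of `B₀`. In particular, we have `μ̃_{τ₁}(z) = 1/z`, where we have identified `ℂ` with `E ⊗_{τ₁} ℝ` through the
  embedding `τ'₁`, which implies that `μ̃ = μ|·|_E^{−1/2}`.  If `m_cusp(π_∞^{(0,1)} ⊗ π^∞) = 1`, then `H¹_B(X, ℂ)[π^∞]` has Hodge type `(0, 1)`.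
  Thus, `μ̃^c` is the associated CM character of `B₀`. In particular, we have `μ̃_{τ₁}(z) = 1/z̄`, which implies that
  `μ̃ = μ^c χ̌ |·|_E^{−1/2}`.»

M. Harris, S. S. Kudla, W. J. Sweet, *Theta dichotomy for unitary groups*, J. Amer. Math. Soc. **9** (1996) 941–1004 [HarrisKudlaSweet1996]
(AMS PDF, journal page = PDF page + 940; held `paper:harris1996-theta-dichotomy-unitary-groups`):
* (1.14)–(1.15), p. 952 (p0012 L22–L27): «`g ↦ ι̃_{V,χ}(g) ≃ (ι_V(g), β_{V,χ}(g))`, (1.14) lifting `ι_V`. Here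
  `β_{V,χ}(g) = χ_V(x(g)) γ_F(η∘R_V)^{−j(g)}`, (1.15) where the notation is as in [22]» — the tree's
  `Literature.RepresentationTheory.HarrisKudlaSweet1996.HKSSplittingDatum.betaOf` / `.beta` (`Splittings.lean`);
* Lemma 1.3 / (1.31), p. 954–955 (p0015 L2–L5): «It is clear that `ι_V(i(Δ(g)))` preserves the complete polarization, and that it acts on
  `Y = V ⊗ Δ(W)` by `1_V ⊗ g`. The element `i(Δ(g)) ∈ G(W + W⁻)` similarly preserves `Y` and acts on `Y` by `g`. Thus `j(i(Δ(g))) = 0` and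
  `x(g) = det(g)`. Thus `β_{V,χ}(i(Δ(g))) = χ_V(det(g))`, (1.31)» — the «`χ(det a)`» token: on the Levi of the Siegel parabolic the
  splitting character is `χ_V` ITSELF at the determinant, no conjugate, no inverse (pub-hodgecm2 cite-1 g86, 22:54Z 2026-08-23).

THE TREE's T-SIGN («MIRROR») FACT — CITED BY NAME, NOT RESTATED, NOT IMPORTED (Literature never imports `Summits.*`):
`Summit.HodgeConjecture.CorCM.D2Bridge.TSign.cmType_eq_lineType_of_isAdmissibleElement`, `….not_isAdmissibleElement_of_deltaNeg`,
`….cmType_eq_lineType_of_omegaPinKey` (file `Summits/HodgeConjecture/CorCM/D2Bridge/OmegaPinTSign.lean`, sha256/16 `678a3688b50b1251`)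
and `HodgeCM.Model.LiuIndex.OmegaPin.TSign.cmType_eq_lineType_indexOfRecord`, `….mem_cmType_and_conjugate_not_mem_indexOfRecord`
(`OmegaPinTSignIndex.lean`, sha256/16 `a8b937b952ddd751`): [Liu2021, Def. 4.12] admissibility of `a·(2δ_L)⁻¹` forces `Φ_μ = lineType a`.
Those are kernel theorems of the summit side; this file states nothing about them.

## What is here

§1 (`namespace HodgeTypeSign`, index types `α` = the basis of `V_+`, `β` = the basis of `V_-`; all DEFINED with bodies, over `ℂ`):
`zeta = e^{iπ/4}`; `aZeta = a(ζ)`, `aZetaInv`; `Jp = Ad(a(ζ))` as a `ℂ`-linear endomorphism of `M_{(p+q)×(p+q)}(ℂ) = End(V)`; `ofHom : B ↦ (0 B; 0 0)`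
(`Hom(V_-, V_+) = M_{p×q}(ℂ) ↪ End V`), `ofHomConj : C ↦ (0 0; C 0)`, `ofPair`; the subspaces `pSub = 𝔭`, `pPrime = 𝔭′`, `pDoublePrime = 𝔭″`;
`xElem α μ = x_{α,μ}`, `yElem α μ = y_{α,μ}`; `hsign` (the diagonal of `( , )`), `herm = ( , )`, `tensorStar v₁ v₂ = v₁ ⊗ v₂^*`;
`tautChart X = X₁₂` (the `V_+`-component of `X|_{V_-}`), `conjChart X = X₂₁`; **`typeSummand a b`** = the type-`(a,b)` summand of `∧¹𝔭 = 𝔭`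
(`a + b = 1`): the `i^a (−i)^b`-eigenspace of `J_𝔭` in `𝔭` (§1.5 / BW II 4.1–4.2).  PROVED unfoldings: `zeta_mul_zeta` (`ζ² = i`),
`aZetaInv_eq_inv`, `Jp_eq_Ad`, `Jp_fromBlocks` (`Ad(a(ζ))(A B; C D) = (A iB; −iC D)`), `Jp_xElem`/`Jp_yElem`, `mem_pPrime_iff_Jp` (§1.5:
`𝔭′ = {X ∈ 𝔭 : J X = iX}`), `xElem_eq_single` (`= (0 1; 0 0)`), `xElem_eq_neg_tensorStar` (`= −v_α ⊗ v_μ^*`), `tensorStar_mulVec`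
(`(v₁ ⊗ v₂^*)(v) = (v, v₂) v₁`), `xElem_mulVec_inr/inl` (`x_{α,μ} : v_μ ↦ v_α`, kills `V_+`: `𝔭′ = Hom(V_-, V_+)`), `tautChart_mulVec`,
`tautChart_Jp`, `conjChart_Jp`, `ad_diagonal_xElem/yElem` (roots `t_α − t_μ`, `t_μ − t_α`), `conj_ofHom` (`Ad(g,h) B = g B h⁻¹`: `𝔭′ ≅ V_+ ⊗ V_-^*`),
**`typeSummand_one_zero : typeSummand 1 0 = 𝔭′`**, `typeSummand_zero_one : typeSummand 0 1 = 𝔭″`, the two archimedean identities of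
[Liu2021] l. 5628/5630 (`arg(z)⁻¹ ‖z‖⁻¹ = 1/z`, `arg(z̄)⁻¹ ‖z‖⁻¹ = 1/z̄`), the sign arithmetic `Re(i⁻¹w) = Im w` of l. 2140 / Def. 4.12 /
Lem. D.2 (2), and the (1.31)-shape of the HKS character (`betaOf χ γ x j g = χ(det g)` when `j(g) = 0`, `x(g) = det g`).
§2 **`structure HodgeTypeSignConvention : Prop`** — one field per printed clause (blocks of sizes `p`, `q`; Liu's case `(p,q) = (n−1,1)`), each
with its locator — and **`def D_BMM : Prop := HodgeTypeSignConvention`** (their conjunction), with **`theorem D_BMM_holds : D_BMM`**: every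
clause is a definitional unfolding or a finite identity, so the packaged convention is INHABITED; what a reader countersigns is the
FAITHFULNESS of each clause to its printed sentence, not its truth.  A consumer that wants the dependence on the [BMM16] labelling to be
visible displays `(hBMM : D_BMM)` next to the row it qualifies; `D_BMM_holds` discharges it.  No clause speaks about tree objects of the
summit side; nothing here is a hypothesis of anything.

NOT here: `(𝔤, K)`-modules, `A_𝔮`, the `K`-types `V(b×q, a×q)` as representations (only their weights on the diagonal torus in degree one),
`∧^{a,b}𝔭` for `a + b ≥ 2` (see `BorelWallach2000.UpqHodgeBigrading.upqType` for all degrees), the Grassmannian as a manifold (the chart is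
recorded through its differential `tautChart` only), [KK07] Thm 5.4 and the identification `π^{1,0} ≅ ω^{−1,−,0}` (Lem. D.2 (2), cited),
Def. 4.5 itself (tree: `Def45AsPrinted`), the T-sign theorems (tree, summit side).

## References
* [BergeronMillsonMoeglin2016Balls] N. Bergeron, J. Millson, C. Moeglin, Acta Math. 216 (2016) 1–125: §1.5, §3.3–3.7, §3.11–3.13, §5.2.1,
  §5.7, §6.3 (= arXiv:1306.1515 §1.5, Part 1 §2.3–2.7, §2.11–2.13, §4.2.1, §4.7, Part 2 §1.3; chunks p0004, p0010–p0014, p0022, p0027, p0030).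
* [Liu2021] Y. Liu, Camb. J. Math. 9 (2021) 1–147 = arXiv:2102.11518: §4.1 l. 1908–1912, l. 1926; Def. 4.5 l. 1936–1964; App. D l. 5265–5294,
  l. 5628–5630 (TeX lines of `FJcycle.tex`).
* [HarrisKudlaSweet1996] M. Harris, S. Kudla, W. Sweet, J. Amer. Math. Soc. 9 (1996): (1.14)–(1.15) p. 952; Lemma 1.3, (1.31) p. 954–955.
* [BorelWallach2000] A. Borel, N. Wallach, Math. Surveys Monogr. 67 (2000), II §4.1–4.2 (the `𝔭^±`, `C^{p,q}` convention; concordance only).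
* [KonnoKonno2007] T. Konno, K. Konno, Kyushu J. Math. 61 (2007), Thm 5.4 (cited through [Liu2021] Lem. D.2 (2) only).
-/

set_option autoImplicit false

noncomputable section

namespace Literature.RepresentationTheory.BergeronMillsonMoeglin2016

namespace HodgeTypeSign

variable (α β : Type*) [Fintype α] [DecidableEq α] [Fintype β] [DecidableEq β]

/-! ## §1.1 `ζ`, `a(ζ)`, `J_𝔭 = Ad(a(ζ))` (§3.5) -/

/-- «Let `ζ = e^{iπ/4}`» — DEFINED. [cite: BergeronMillsonMoeglin2016Balls, §3.5 (arXiv 1306.1515 p0011 L50)] -/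
def zeta : ℂ := Complex.exp ((Real.pi : ℂ) / 4 * Complex.I)

/-- «Then `ζ` satisfies `ζ² = i`.» [cite: BergeronMillsonMoeglin2016Balls, §3.5 (p0011 L50)] -/
theorem zeta_mul_zeta : zeta * zeta = Complex.I := by
  rw [zeta, ← Complex.exp_add]
  have h : (Real.pi : ℂ) / 4 * Complex.I + (Real.pi : ℂ) / 4 * Complex.I = (Real.pi : ℂ) / 2 * Complex.I := by ring
  rw [h, Complex.exp_mul_I, Complex.cos_pi_div_two, Complex.sin_pi_div_two, zero_add, one_mul]

/-- `ζ² = i`. [cite: BergeronMillsonMoeglin2016Balls, §3.5 (p0011 L50)] -/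
theorem zeta_sq : zeta ^ 2 = Complex.I := by
  rw [sq, zeta_mul_zeta]

/-- `ζ ≠ 0` (`ζ = e^{iπ/4}`). [cite: BergeronMillsonMoeglin2016Balls, §3.5 (p0011 L50)] -/
theorem zeta_ne_zero : zeta ≠ 0 := Complex.exp_ne_zero _

/-- `ζ⁻¹ ζ⁻¹ = i⁻¹ = −i` (from «`ζ² = i`»; the eigenvalue of `Ad(a(ζ))` on `𝔭″`, «`J_𝔭 y_{α,μ} = −i y_{α,μ}`»).
[cite: BergeronMillsonMoeglin2016Balls, §3.5–3.6 (p0011 L50, L80)] -/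
theorem zeta_inv_mul_zeta_inv : zeta⁻¹ * zeta⁻¹ = -Complex.I := by
  rw [← mul_inv, zeta_mul_zeta, Complex.inv_I]

/-- «Let `a(ζ)` be the diagonal `m` by `m` block matrix given by `a(ζ) = (ζ 0; 0 ζ⁻¹)`» (blocks of sizes `p = |α|`, `q = |β|`) — DEFINED.
[cite: BergeronMillsonMoeglin2016Balls, §3.5 (p0011 L50–L56)] -/
def aZeta : Matrix (α ⊕ β) (α ⊕ β) ℂ :=
  Matrix.fromBlocks (zeta • (1 : Matrix α α ℂ)) 0 0 (zeta⁻¹ • (1 : Matrix β β ℂ))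

/-- The block matrix `(ζ⁻¹ 0; 0 ζ)`, the inverse of `a(ζ)` (`aZetaInv_eq_inv`). [cite: BergeronMillsonMoeglin2016Balls, §3.5 (p0011 L54–L56)] -/
def aZetaInv : Matrix (α ⊕ β) (α ⊕ β) ℂ :=
  Matrix.fromBlocks (zeta⁻¹ • (1 : Matrix α α ℂ)) 0 0 (zeta • (1 : Matrix β β ℂ))

/-- `a(ζ) · (ζ⁻¹ 0; 0 ζ) = 1`: «`a(ζ) = (ζ 0; 0 ζ⁻¹)`» is invertible (it «is in the center of `U(p) × U(q)`»).
[cite: BergeronMillsonMoeglin2016Balls, §3.5 (p0011 L54–L58)] -/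
theorem aZeta_mul_aZetaInv : aZeta α β * aZetaInv α β = 1 := by
  simp [aZeta, aZetaInv, Matrix.fromBlocks_multiply, smul_smul, zeta_ne_zero]

/-- `(ζ⁻¹ 0; 0 ζ) = a(ζ)⁻¹` (the inverse used in «`Ad(a(ζ))`»). [cite: BergeronMillsonMoeglin2016Balls, §3.5 (p0011 L54–L61)] -/
theorem aZetaInv_eq_inv : aZetaInv α β = (aZeta α β)⁻¹ :=
  (Matrix.inv_eq_right_inv (aZeta_mul_aZetaInv α β)).symm

/-- «`a(ζ) v_α = ζ v_α`» (`v_α ∈ V_+`). [cite: BergeronMillsonMoeglin2016Balls, §3.5 (p0011 L67)] -/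
theorem aZeta_mulVec_inl (a : α) :
    Matrix.mulVec (aZeta α β) (Pi.single (Sum.inl a) 1) = zeta • Pi.single (Sum.inl a) 1 := by
  ext i
  rcases i with i | i <;>
    simp [aZeta, Matrix.mulVec, dotProduct, Pi.single_apply, Matrix.one_apply]

/-- «`a(ζ) v_μ = ζ⁻¹ v_μ`» (`v_μ ∈ V_-`). [cite: BergeronMillsonMoeglin2016Balls, §3.5 (p0011 L67)] -/
theorem aZeta_mulVec_inr (m : β) :
    Matrix.mulVec (aZeta α β) (Pi.single (Sum.inr m) 1) = zeta⁻¹ • Pi.single (Sum.inr m) 1 := by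
  ext i
  rcases i with i | i <;>
    simp [aZeta, Matrix.mulVec, dotProduct, Pi.single_apply, Matrix.one_apply]

/-- **«`J_𝔭 = Ad(a(ζ))`»** — the almost complex structure on `𝔭` «that induces the structure of Hermitian symmetric space on
`U(p,q)/(U(p) × U(q))`», DEFINED as the `ℂ`-linear endomorphism `X ↦ a(ζ) X a(ζ)⁻¹` of `End(V) = M_{(p+q)×(p+q)}(ℂ) ≅ 𝔤` (it is `Ad(a(ζ))`
on all of `𝔤`; on `𝔨` it is the identity, `Jp_fromBlocks`). [cite: BergeronMillsonMoeglin2016Balls, §3.5 (p0011 L49–L62)] -/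
def Jp : Module.End ℂ (Matrix (α ⊕ β) (α ⊕ β) ℂ) where
  toFun X := aZeta α β * X * aZetaInv α β
  map_add' X Y := by rw [Matrix.mul_add, Matrix.add_mul]
  map_smul' c X := by simp only [RingHom.id_apply, Matrix.mul_smul, Matrix.smul_mul]

/-- Unfolding of `J_𝔭`. [cite: BergeronMillsonMoeglin2016Balls, §3.5 (p0011 L61)] -/
theorem Jp_apply (X : Matrix (α ⊕ β) (α ⊕ β) ℂ) : Jp α β X = aZeta α β * X * aZetaInv α β := rfl

/-- «`J_𝔭 = Ad(a(ζ))`»: `J_𝔭 X = a(ζ) X a(ζ)⁻¹`. [cite: BergeronMillsonMoeglin2016Balls, §3.5 (p0011 L61)] -/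
theorem Jp_eq_Ad (X : Matrix (α ⊕ β) (α ⊕ β) ℂ) : Jp α β X = aZeta α β * X * (aZeta α β)⁻¹ := by
  rw [Jp_apply, aZetaInv_eq_inv]

/-- **`Ad(a(ζ))` in blocks**: `Ad(a(ζ)) (A B; C D) = (A, ζ²B; ζ⁻²C, D) = (A, iB; −iC, D)` — the identity on `𝔨 = (A 0; 0 D)`, `+i` on the
upper-right block, `−i` on the lower-left block. [cite: BergeronMillsonMoeglin2016Balls, §3.5–3.6 (p0011 L61, L79–L80)] -/
theorem Jp_fromBlocks (A : Matrix α α ℂ) (B : Matrix α β ℂ) (C : Matrix β α ℂ) (D : Matrix β β ℂ) :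
    Jp α β (Matrix.fromBlocks A B C D) = Matrix.fromBlocks A (Complex.I • B) ((-Complex.I) • C) D := by
  simp only [Jp_apply, aZeta, aZetaInv, Matrix.fromBlocks_multiply, Matrix.smul_mul, Matrix.mul_smul, Matrix.one_mul,
    Matrix.mul_one, Matrix.zero_mul, Matrix.mul_zero, add_zero, zero_add, smul_smul, zeta_mul_zeta,
    zeta_inv_mul_zeta_inv, mul_inv_cancel₀ zeta_ne_zero, inv_mul_cancel₀ zeta_ne_zero, one_smul]

/-! ## §1.2 `𝔭 = (V_+ ⊗ V_-^*) ⊕ (V_- ⊗ V_+^*)`, `𝔭′ = V_+ ⊗ V_-^* = Hom(V_-, V_+)`, `𝔭″ = V_- ⊗ V_+^*` (§3.3–3.6) -/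

/-- **`Hom(V_-, V_+) = M_{p×q}(ℂ) ↪ End(V)`, `B ↦ (0 B; 0 0)`** — the matrix realisation «`𝔭′ = V_+ ⊗ V_-^* = {(0 B; 0 0) : B ∈ M_{p×q}(ℂ)}`»,
«`𝔭′ ≅ M_{p×q}(ℂ)`»; a matrix `(0 B; 0 0)` kills `V_+` and maps `V_-` into `V_+` by `B`.  DEFINED (`ℂ`-linear).
[cite: BergeronMillsonMoeglin2016Balls, §3.6 (p0011 L85–L86, L99)] -/
def ofHom : Matrix α β ℂ →ₗ[ℂ] Matrix (α ⊕ β) (α ⊕ β) ℂ where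
  toFun B := Matrix.fromBlocks 0 B 0 0
  map_add' B B' := by simp only [Matrix.fromBlocks_add, add_zero]
  map_smul' c B := by simp only [RingHom.id_apply, Matrix.fromBlocks_smul, smul_zero]

/-- `V_- ⊗ V_+^* = Hom(V_+, V_-) = M_{q×p}(ℂ) ↪ End(V)`, `C ↦ (0 0; C 0)` — «`𝔭″ = V_- ⊗ V_+^* = {(0 0; C 0) : C ∈ M_{q×p}(ℂ)}`».  DEFINED.
[cite: BergeronMillsonMoeglin2016Balls, §3.6 (p0011 L90–L91, L99)] -/
def ofHomConj : Matrix β α ℂ →ₗ[ℂ] Matrix (α ⊕ β) (α ⊕ β) ℂ where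
  toFun C := Matrix.fromBlocks 0 0 C 0
  map_add' C C' := by simp only [Matrix.fromBlocks_add, add_zero]
  map_smul' c C := by simp only [RingHom.id_apply, Matrix.fromBlocks_smul, smul_zero]

/-- `(B, C) ↦ (0 B; C 0)` — «`𝔭 = (0 B; C 0)` with `B`, resp. `C`, an arbitrary `p` by `q`, resp. `q` by `p`, complex matrix».  DEFINED.
[cite: BergeronMillsonMoeglin2016Balls, §3.4 (p0011 L4–L5)] -/
def ofPair : Matrix α β ℂ × Matrix β α ℂ →ₗ[ℂ] Matrix (α ⊕ β) (α ⊕ β) ℂ where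
  toFun P := Matrix.fromBlocks 0 P.1 P.2 0
  map_add' P P' := by simp only [Prod.fst_add, Prod.snd_add, Matrix.fromBlocks_add, add_zero]
  map_smul' c P := by simp only [Prod.smul_fst, Prod.smul_snd, RingHom.id_apply, Matrix.fromBlocks_smul, smul_zero]

omit [Fintype α] [DecidableEq α] [Fintype β] [DecidableEq β] in
/-- Unfolding. [cite: BergeronMillsonMoeglin2016Balls, §3.6 (p0011 L85–L86)] -/
@[simp] theorem ofHom_apply (B : Matrix α β ℂ) : ofHom α β B = Matrix.fromBlocks 0 B 0 0 := rfl

omit [Fintype α] [DecidableEq α] [Fintype β] [DecidableEq β] in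
/-- Unfolding. [cite: BergeronMillsonMoeglin2016Balls, §3.6 (p0011 L90–L91)] -/
@[simp] theorem ofHomConj_apply (C : Matrix β α ℂ) : ofHomConj α β C = Matrix.fromBlocks 0 0 C 0 := rfl

omit [Fintype α] [DecidableEq α] [Fintype β] [DecidableEq β] in
/-- Unfolding. [cite: BergeronMillsonMoeglin2016Balls, §3.4 (p0011 L4–L5)] -/
@[simp] theorem ofPair_apply (P : Matrix α β ℂ × Matrix β α ℂ) : ofPair α β P = Matrix.fromBlocks 0 P.1 P.2 0 := rfl

/-- **`𝔭`** (complexified): «`𝔭 = (V_+ ⊗ V_-^*) ⊕ (V_- ⊗ V_+^*)`» = «`(0 B; C 0)`», as a `ℂ`-subspace of `End(V)`.  DEFINED.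
[cite: BergeronMillsonMoeglin2016Balls, §3.3 (p0010 L75), §3.4 (p0011 L4–L5)] -/
def pSub : Submodule ℂ (Matrix (α ⊕ β) (α ⊕ β) ℂ) := LinearMap.range (ofPair α β)

/-- **`𝔭′ = V_+ ⊗ V_-^* = {(0 B; 0 0) : B ∈ M_{p×q}(ℂ)}`** = `Hom(V_-, V_+)`.  DEFINED.
[cite: BergeronMillsonMoeglin2016Balls, §3.6 (p0011 L83–L86)] -/
def pPrime : Submodule ℂ (Matrix (α ⊕ β) (α ⊕ β) ℂ) := LinearMap.range (ofHom α β)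

/-- **`𝔭″ = V_- ⊗ V_+^* = {(0 0; C 0) : C ∈ M_{q×p}(ℂ)}`** = `Hom(V_+, V_-)`.  DEFINED.
[cite: BergeronMillsonMoeglin2016Balls, §3.6 (p0011 L88–L91)] -/
def pDoublePrime : Submodule ℂ (Matrix (α ⊕ β) (α ⊕ β) ℂ) := LinearMap.range (ofHomConj α β)

variable {α β}

omit [Fintype α] [DecidableEq α] [Fintype β] [DecidableEq β] in
/-- Every matrix is a block matrix. [folklore] -/
private theorem exists_eq_fromBlocks (X : Matrix (α ⊕ β) (α ⊕ β) ℂ) :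
    ∃ (A : Matrix α α ℂ) (B : Matrix α β ℂ) (C : Matrix β α ℂ) (D : Matrix β β ℂ), X = Matrix.fromBlocks A B C D :=
  ⟨_, _, _, _, (Matrix.fromBlocks_toBlocks X).symm⟩

omit [Fintype α] [DecidableEq α] [Fintype β] [DecidableEq β] in
/-- `X ∈ 𝔭` iff its diagonal blocks vanish. [cite: BergeronMillsonMoeglin2016Balls, §3.4 (p0011 L4–L5)] -/
theorem mem_pSub_iff {X : Matrix (α ⊕ β) (α ⊕ β) ℂ} : X ∈ pSub α β ↔ X.toBlocks₁₁ = 0 ∧ X.toBlocks₂₂ = 0 := by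
  rw [pSub, LinearMap.mem_range]
  constructor
  · rintro ⟨P, rfl⟩
    simp only [ofPair_apply, Matrix.toBlocks_fromBlocks₁₁, Matrix.toBlocks_fromBlocks₂₂, and_self]
  · rintro ⟨h₁, h₂⟩
    refine ⟨(X.toBlocks₁₂, X.toBlocks₂₁), ?_⟩
    have h := Matrix.fromBlocks_toBlocks X
    rw [h₁, h₂] at h
    rw [ofPair_apply]
    exact h

omit [Fintype α] [DecidableEq α] [Fintype β] [DecidableEq β] in
/-- `X ∈ 𝔭′` iff only its upper-right block is non-zero. [cite: BergeronMillsonMoeglin2016Balls, §3.6 (p0011 L85–L86)] -/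
theorem mem_pPrime_iff {X : Matrix (α ⊕ β) (α ⊕ β) ℂ} :
    X ∈ pPrime α β ↔ X.toBlocks₁₁ = 0 ∧ X.toBlocks₂₁ = 0 ∧ X.toBlocks₂₂ = 0 := by
  rw [pPrime, LinearMap.mem_range]
  constructor
  · rintro ⟨B, rfl⟩
    simp only [ofHom_apply, Matrix.toBlocks_fromBlocks₁₁, Matrix.toBlocks_fromBlocks₂₁, Matrix.toBlocks_fromBlocks₂₂,
      and_self]
  · rintro ⟨h₁, h₂, h₃⟩
    refine ⟨X.toBlocks₁₂, ?_⟩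
    have h := Matrix.fromBlocks_toBlocks X
    rw [h₁, h₂, h₃] at h
    rw [ofHom_apply]
    exact h

omit [Fintype α] [DecidableEq α] [Fintype β] [DecidableEq β] in
/-- `X ∈ 𝔭″` iff only its lower-left block is non-zero. [cite: BergeronMillsonMoeglin2016Balls, §3.6 (p0011 L90–L91)] -/
theorem mem_pDoublePrime_iff {X : Matrix (α ⊕ β) (α ⊕ β) ℂ} :
    X ∈ pDoublePrime α β ↔ X.toBlocks₁₁ = 0 ∧ X.toBlocks₁₂ = 0 ∧ X.toBlocks₂₂ = 0 := by
  rw [pDoublePrime, LinearMap.mem_range]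
  constructor
  · rintro ⟨C, rfl⟩
    simp only [ofHomConj_apply, Matrix.toBlocks_fromBlocks₁₁, Matrix.toBlocks_fromBlocks₁₂, Matrix.toBlocks_fromBlocks₂₂,
      and_self]
  · rintro ⟨h₁, h₂, h₃⟩
    refine ⟨X.toBlocks₂₁, ?_⟩
    have h := Matrix.fromBlocks_toBlocks X
    rw [h₁, h₂, h₃] at h
    rw [ofHomConj_apply]
    exact h

omit [Fintype α] [DecidableEq α] [Fintype β] [DecidableEq β] in
/-- `(0 B; 0 0) ∈ 𝔭′`. [cite: BergeronMillsonMoeglin2016Balls, §3.6 (p0011 L85–L86)] -/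
theorem fromBlocks_mem_pPrime (B : Matrix α β ℂ) : Matrix.fromBlocks 0 B 0 0 ∈ pPrime α β := ⟨B, rfl⟩

omit [Fintype α] [DecidableEq α] [Fintype β] [DecidableEq β] in
/-- `(0 0; C 0) ∈ 𝔭″`. [cite: BergeronMillsonMoeglin2016Balls, §3.6 (p0011 L90–L91)] -/
theorem fromBlocks_mem_pDoublePrime (C : Matrix β α ℂ) : Matrix.fromBlocks 0 0 C 0 ∈ pDoublePrime α β := ⟨C, rfl⟩

omit [Fintype α] [DecidableEq α] [Fintype β] [DecidableEq β] in
/-- `(0 B; C 0) ∈ 𝔭`. [cite: BergeronMillsonMoeglin2016Balls, §3.4 (p0011 L4–L5)] -/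
theorem fromBlocks_mem_pSub (B : Matrix α β ℂ) (C : Matrix β α ℂ) : Matrix.fromBlocks 0 B C 0 ∈ pSub α β := ⟨(B, C), rfl⟩

/-- «the above splitting into `B, C` blocks corresponds to the splitting `𝔭 = 𝔭′ + 𝔭″`»: `𝔭′ ⊔ 𝔭″ = 𝔭`.
[cite: BergeronMillsonMoeglin2016Balls, §3.6 (p0011 L101)] -/
theorem pPrime_sup_pDoublePrime : pPrime α β ⊔ pDoublePrime α β = pSub α β := by
  apply le_antisymm
  · refine sup_le ?_ ?_
    · rintro X ⟨B, rfl⟩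
      exact fromBlocks_mem_pSub B 0
    · rintro X ⟨C, rfl⟩
      exact fromBlocks_mem_pSub 0 C
  · rintro X ⟨P, rfl⟩
    have h : Matrix.fromBlocks 0 P.1 P.2 0 = Matrix.fromBlocks 0 P.1 0 0 + Matrix.fromBlocks 0 0 P.2 (0 : Matrix β β ℂ) := by
      simp only [Matrix.fromBlocks_add, add_zero, zero_add]
    rw [ofPair_apply, h]
    exact Submodule.add_mem_sup (fromBlocks_mem_pPrime P.1) (fromBlocks_mem_pDoublePrime P.2)

omit [Fintype α] [DecidableEq α] [Fintype β] [DecidableEq β] in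
/-- … and `𝔭′ ∩ 𝔭″ = 0`. [cite: BergeronMillsonMoeglin2016Balls, §3.6 (p0011 L101)] -/
theorem pPrime_inf_pDoublePrime : pPrime α β ⊓ pDoublePrime α β = ⊥ := by
  rw [eq_bot_iff]
  intro X hX
  obtain ⟨h₁, h₂⟩ := Submodule.mem_inf.mp hX
  obtain ⟨h11, h21, h22⟩ := mem_pPrime_iff.mp h₁
  obtain ⟨-, h12, -⟩ := mem_pDoublePrime_iff.mp h₂
  rw [Submodule.mem_bot, ← Matrix.fromBlocks_toBlocks X, h11, h12, h21, h22, Matrix.fromBlocks_zero]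

omit [DecidableEq α] [DecidableEq β] in
/-- «As a representation of `GL(p,ℂ) × GL(q,ℂ)` the space `𝔭′` is isomorphic to `V_+ ⊗ V_-^*`»: `Ad(g, h)(0 B; 0 0) = (0, gBh′; 0, 0)` for
block-diagonal `(g 0; 0 h)` with `h h′ = 1` — `𝔭′ = Hom(V_-, V_+)` with `K_ℂ` acting by `B ↦ g B h⁻¹`.
[cite: BergeronMillsonMoeglin2016Balls, §1.5 (p0004 L59), §3.6 (p0011 L97–L99)] -/
theorem conj_ofHom (g : Matrix α α ℂ) (h h' : Matrix β β ℂ) (g' : Matrix α α ℂ) (B : Matrix α β ℂ) :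
    Matrix.fromBlocks g 0 0 h * Matrix.fromBlocks 0 B 0 0 * Matrix.fromBlocks g' 0 0 h' =
      Matrix.fromBlocks 0 (g * B * h') 0 0 := by
  simp [Matrix.fromBlocks_multiply]

/-! ## §1.3 `J_𝔭` on `𝔭`: `𝔭′` is the `+i`-eigenspace, `𝔭″` the `−i`-eigenspace (§1.5, §3.6) -/

/-- `J_𝔭 (0 B; C 0) = (0, iB; −iC, 0)`. [cite: BergeronMillsonMoeglin2016Balls, §3.6 (p0011 L79–L80)] -/
theorem Jp_fromBlocks_offDiag (B : Matrix α β ℂ) (C : Matrix β α ℂ) :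
    Jp α β (Matrix.fromBlocks 0 B C 0) = Matrix.fromBlocks 0 (Complex.I • B) ((-Complex.I) • C) 0 :=
  Jp_fromBlocks α β 0 B C 0

/-- `(−i) C = i C` forces `C = 0` (over `ℂ`). [folklore] -/
private theorem eq_zero_of_neg_I_smul_eq {ι κ : Type*} {C : Matrix ι κ ℂ} (h : (-Complex.I) • C = Complex.I • C) : C = 0 := by
  have hne : (2 * Complex.I : ℂ) ≠ 0 := mul_ne_zero two_ne_zero Complex.I_ne_zero
  have h2 : (2 * Complex.I) • C = 0 := by
    rw [mul_smul, two_smul]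
    nth_rw 1 [← h]
    rw [neg_smul, neg_add_cancel]
  calc C = ((2 * Complex.I)⁻¹ * (2 * Complex.I)) • C := by rw [inv_mul_cancel₀ hne, one_smul]
    _ = (2 * Complex.I)⁻¹ • ((2 * Complex.I) • C) := mul_smul _ _ _
    _ = 0 := by rw [h2, smul_zero]

/-- **§1.5: «`𝔭′ = {X ∈ 𝔭 : Ad(c) X = iX}` … is the holomorphic tangent space»** with `c = a(ζ)` («`Ad(a(ζ))` … induces the required almost
complex structure», §3.5): the matrix space `𝔭′ = {(0 B; 0 0)}` of §3.6 IS the `+i`-eigenspace of `J_𝔭` in `𝔭`.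
[cite: BergeronMillsonMoeglin2016Balls, §1.5 (p0004 L56–L57), §3.5 (p0011 L58–L61), §3.6 (p0011 L79, L83–L86)] -/
theorem mem_pPrime_iff_Jp {X : Matrix (α ⊕ β) (α ⊕ β) ℂ} :
    X ∈ pPrime α β ↔ X ∈ pSub α β ∧ Jp α β X = Complex.I • X := by
  constructor
  · rintro ⟨B, rfl⟩
    refine ⟨fromBlocks_mem_pSub B 0, ?_⟩
    simp only [ofHom_apply, Jp_fromBlocks, Matrix.fromBlocks_smul, smul_zero]
  · rintro ⟨⟨P, rfl⟩, hJ⟩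
    simp only [ofPair_apply, Jp_fromBlocks, Matrix.fromBlocks_smul, smul_zero] at hJ
    obtain ⟨-, -, hC, -⟩ := Matrix.fromBlocks_inj.mp hJ
    rw [ofPair_apply, eq_zero_of_neg_I_smul_eq hC]
    exact fromBlocks_mem_pPrime P.1

/-- `𝔭″ = {(0 0; C 0)}` is the `−i`-eigenspace of `J_𝔭` in `𝔭` («`J_𝔭 y_{α,μ} = −i y_{α,μ}`», «`σ₀(𝔭′) = 𝔭″`»).
[cite: BergeronMillsonMoeglin2016Balls, §3.6 (p0011 L80, L88–L95)] -/
theorem mem_pDoublePrime_iff_Jp {X : Matrix (α ⊕ β) (α ⊕ β) ℂ} :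
    X ∈ pDoublePrime α β ↔ X ∈ pSub α β ∧ Jp α β X = (-Complex.I) • X := by
  constructor
  · rintro ⟨C, rfl⟩
    refine ⟨fromBlocks_mem_pSub 0 C, ?_⟩
    simp only [ofHomConj_apply, Jp_fromBlocks, Matrix.fromBlocks_smul, smul_zero]
  · rintro ⟨⟨P, rfl⟩, hJ⟩
    simp only [ofPair_apply, Jp_fromBlocks, Matrix.fromBlocks_smul, smul_zero] at hJ
    obtain ⟨-, hB, -, -⟩ := Matrix.fromBlocks_inj.mp hJ
    rw [ofPair_apply, eq_zero_of_neg_I_smul_eq hB.symm]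
    exact fromBlocks_mem_pDoublePrime P.2

/-! ## §1.4 The basis vectors `x_{α,μ}`, `y_{α,μ}`; `( , )`, `v ⊗ w^*`; `x_{α,μ} = −v_α ⊗ v_μ^* : v_μ ↦ v_α` (§3.4–3.6) -/

/-- **`x_{α,μ} = (0 1; 0 0)`** (the `1` in row `α ∈ V_+`, column `μ ∈ V_-`) — DEFINED as `(0 E_{αμ}; 0 0)`; `= −v_α ⊗ v_μ^*`
(`xElem_eq_neg_tensorStar`). [cite: BergeronMillsonMoeglin2016Balls, §3.6 (p0011 L79)] -/
def xElem (a : α) (m : β) : Matrix (α ⊕ β) (α ⊕ β) ℂ := Matrix.fromBlocks 0 (Matrix.single a m 1) 0 0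

/-- **`y_{α,μ} = σ₀(x_{α,μ}) = v_μ ⊗ v_α^* = (0 0; 1 0)`** — DEFINED as `(0 0; E_{μα} 0)`. [cite: BergeronMillsonMoeglin2016Balls, §3.6 (p0011 L80)] -/
def yElem (a : α) (m : β) : Matrix (α ⊕ β) (α ⊕ β) ℂ := Matrix.fromBlocks 0 0 (Matrix.single m a 1) 0

omit [Fintype α] [Fintype β] in
/-- `x_{α,μ}` is the matrix unit `E_{α,μ}` of `End(V)`. [cite: BergeronMillsonMoeglin2016Balls, §3.6 (p0011 L79)] -/
theorem xElem_eq_single (a : α) (m : β) : xElem (α := α) (β := β) a m = Matrix.single (Sum.inl a) (Sum.inr m) 1 := by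
  ext i j
  rcases i with i | i <;> rcases j with j | j <;> simp [xElem, Matrix.single_apply]

omit [Fintype α] [Fintype β] in
/-- `y_{α,μ}` is the matrix unit `E_{μ,α}`. [cite: BergeronMillsonMoeglin2016Balls, §3.6 (p0011 L80)] -/
theorem yElem_eq_single (a : α) (m : β) : yElem (α := α) (β := β) a m = Matrix.single (Sum.inr m) (Sum.inl a) 1 := by
  ext i j
  rcases i with i | i <;> rcases j with j | j <;> simp [yElem, Matrix.single_apply]

omit [Fintype α] [Fintype β] in
/-- `x_{α,μ} ∈ 𝔭′`. [cite: BergeronMillsonMoeglin2016Balls, §3.6 (p0011 L76, L83)] -/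
theorem xElem_mem_pPrime (a : α) (m : β) : xElem a m ∈ pPrime α β := fromBlocks_mem_pPrime _

omit [Fintype α] [Fintype β] in
/-- `y_{α,μ} ∈ 𝔭″`. [cite: BergeronMillsonMoeglin2016Balls, §3.6 (p0011 L76, L88)] -/
theorem yElem_mem_pDoublePrime (a : α) (m : β) : yElem a m ∈ pDoublePrime α β := fromBlocks_mem_pDoublePrime _

/-- **«whence `J_𝔭 x_{α,μ} = i x_{α,μ}`».** [cite: BergeronMillsonMoeglin2016Balls, §3.6 (p0011 L79)] -/
theorem Jp_xElem (a : α) (m : β) : Jp α β (xElem a m) = Complex.I • xElem a m := by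
  simp only [xElem, Jp_fromBlocks, Matrix.fromBlocks_smul, smul_zero]

/-- **«whence `J_𝔭 y_{α,μ} = −i y_{α,μ}`».** [cite: BergeronMillsonMoeglin2016Balls, §3.6 (p0011 L80)] -/
theorem Jp_yElem (a : α) (m : β) : Jp α β (yElem a m) = (-Complex.I) • yElem a m := by
  simp only [yElem, Jp_fromBlocks, Matrix.fromBlocks_smul, smul_zero]

/-- «The set `{x_{α,μ}}` is a basis for `𝔭′`»: `𝔭′` is the span of the `x_{α,μ}`. [cite: BergeronMillsonMoeglin2016Balls, §3.6 (p0011 L83)] -/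
theorem pPrime_eq_span : pPrime α β = Submodule.span ℂ (Set.range fun am : α × β => xElem (α := α) (β := β) am.1 am.2) := by
  apply le_antisymm
  · rintro X ⟨B, rfl⟩
    have hB : B = ∑ a : α, ∑ m : β, B a m • Matrix.single a m (1 : ℂ) := by
      simp only [Matrix.smul_single, smul_eq_mul, mul_one]
      exact Matrix.matrix_eq_sum_single B
    rw [hB, map_sum]
    refine Submodule.sum_mem _ fun a _ => ?_
    rw [map_sum]
    refine Submodule.sum_mem _ fun m _ => ?_
    rw [map_smul]
    exact Submodule.smul_mem _ _ (Submodule.subset_span ⟨(a, m), rfl⟩)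
  · rw [Submodule.span_le]
    rintro X ⟨am, rfl⟩
    exact xElem_mem_pPrime am.1 am.2

/-- The diagonal of the Hermitian form: `(v_α, v_α) = 1` on `V_+`, `(v_μ, v_μ) = −1` on `V_-` — «the matrix of the Hermitian form `( , )` … is
the diagonal matrix `(1_p 0; 0 −1_q)`».  DEFINED. [cite: BergeronMillsonMoeglin2016Balls, §3.4 (p0010 L84–L88)] -/
def hsign : α ⊕ β → ℂ := Sum.elim (fun _ => 1) (fun _ => -1)

/-- **The Hermitian form `(u, v) = Σ_α u_α v̄_α − Σ_μ u_μ v̄_μ`** (linear in `u`, conjugate-linear in `v`, as «`(v₁ ⊗ v₂^*)(v) = (v, v₂) v₁`»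
requires).  DEFINED. [cite: BergeronMillsonMoeglin2016Balls, §3.4 (p0010 L84–L88), §3.5 (p0011 L9–L18)] -/
def herm (u v : α ⊕ β → ℂ) : ℂ := ∑ j, u j * (hsign (α := α) (β := β) j * star (v j))

/-- **«`v₁ ⊗ v₂^* ∈ V ⊗ V^* = End(V)`», the endomorphism `v ↦ (v, v₂) v₁`** — DEFINED as the matrix whose column `j` is `(v_j, v₂) v₁`.
[cite: BergeronMillsonMoeglin2016Balls, §3.5 (p0011 L15–L22)] -/
def tensorStar (v₁ v₂ : α ⊕ β → ℂ) : Matrix (α ⊕ β) (α ⊕ β) ℂ :=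
  Matrix.of fun i j => v₁ i * (hsign (α := α) (β := β) j * star (v₂ j))

omit [DecidableEq α] [DecidableEq β] in
/-- **«`(v₁ ⊗ v₂^*)(v) = (v, v₂) v₁`».** [cite: BergeronMillsonMoeglin2016Balls, §3.5 (p0011 L17–L19)] -/
theorem tensorStar_mulVec (v₁ v₂ v : α ⊕ β → ℂ) :
    Matrix.mulVec (tensorStar v₁ v₂) v = herm (α := α) (β := β) v v₂ • v₁ := by
  ext i
  simp only [Matrix.mulVec, dotProduct, tensorStar, Matrix.of_apply, herm, Pi.smul_apply, smul_eq_mul,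
    Finset.sum_mul]
  exact Finset.sum_congr rfl fun j _ => by ring

/-- «`(v_α, v_β) = δ_{α,β}`» [cite: BergeronMillsonMoeglin2016Balls, §3.4 (p0010 L84)] -/
theorem herm_inl_inl (a a' : α) :
    herm (α := α) (β := β) (Pi.single (Sum.inl a) 1) (Pi.single (Sum.inl a') 1) = if a = a' then 1 else 0 := by
  by_cases h : a = a'
  · subst h
    simp [herm, hsign, Pi.single_apply, apply_ite (star : ℂ → ℂ)]
  · simp [herm, hsign, Pi.single_apply, apply_ite (star : ℂ → ℂ), h, Ne.symm h]

/-- «`(v_μ, v_ν) = −δ_{μ,ν}`» [cite: BergeronMillsonMoeglin2016Balls, §3.4 (p0010 L84)] -/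
theorem herm_inr_inr (m m' : β) :
    herm (α := α) (β := β) (Pi.single (Sum.inr m) 1) (Pi.single (Sum.inr m') 1) = if m = m' then -1 else 0 := by
  by_cases h : m = m'
  · subst h
    simp [herm, hsign, Pi.single_apply, apply_ite (star : ℂ → ℂ)]
  · simp [herm, hsign, Pi.single_apply, apply_ite (star : ℂ → ℂ), h, Ne.symm h]

/-- `V_+ ⊥ V_-`: «`V_+ ⊂ V` … the orthogonal complement of `V_-`». [cite: BergeronMillsonMoeglin2016Balls, §3.4 (p0010 L84), §6.3 (p0030 L19)] -/
theorem herm_inl_inr (a : α) (m : β) :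
    herm (α := α) (β := β) (Pi.single (Sum.inl a) 1) (Pi.single (Sum.inr m) 1) = 0 := by
  simp [herm, hsign, Pi.single_apply, apply_ite (star : ℂ → ℂ)]

omit [Fintype α] [Fintype β] in
/-- **«`x_{α,μ} = −v_α ⊗ v_μ^*`».** [cite: BergeronMillsonMoeglin2016Balls, §3.6 (p0011 L79)] -/
theorem xElem_eq_neg_tensorStar (a : α) (m : β) :
    xElem (α := α) (β := β) a m = -tensorStar (Pi.single (Sum.inl a) 1) (Pi.single (Sum.inr m) 1) := by
  ext i j
  rcases i with i | i <;> rcases j with j | j <;>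
    simp [xElem_eq_single, Matrix.single_apply, tensorStar, hsign, Pi.single_apply, apply_ite (star : ℂ → ℂ)]
  aesop

omit [Fintype α] [Fintype β] in
/-- **«`y_{α,μ} = v_μ ⊗ v_α^*`».** [cite: BergeronMillsonMoeglin2016Balls, §3.6 (p0011 L80)] -/
theorem yElem_eq_tensorStar (a : α) (m : β) :
    yElem (α := α) (β := β) a m = tensorStar (Pi.single (Sum.inr m) 1) (Pi.single (Sum.inl a) 1) := by
  ext i j
  rcases i with i | i <;> rcases j with j | j <;>
    simp [yElem_eq_single, Matrix.single_apply, tensorStar, hsign, Pi.single_apply, apply_ite (star : ℂ → ℂ)]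
  aesop

/-- **`x_{α,μ} : v_μ ↦ v_α`** — an element of `𝔭′ = V_+ ⊗ V_-^*` maps `V_-` to `V_+`: `𝔭′ = Hom(V_-, V_+)` (the TAUTOLOGICAL direction:
tangent vectors to the space of `q`-planes at `V_-` are maps `V_- → V/V_- = V_+`). [cite: BergeronMillsonMoeglin2016Balls, §1.5 (p0004 L59), §3.5–3.6 (p0011 L18, L79)] -/
theorem xElem_mulVec_inr (a : α) (m : β) :
    Matrix.mulVec (xElem (α := α) (β := β) a m) (Pi.single (Sum.inr m) 1) = Pi.single (Sum.inl a) 1 := by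
  ext i
  rcases i with i | i <;>
    simp [xElem_eq_single, Matrix.mulVec, dotProduct, Matrix.single_apply, Pi.single_apply]
  aesop

/-- … and kills `V_+`: `x_{α,μ}(v_{α'}) = −(v_{α'}, v_μ) v_α = 0`. [cite: BergeronMillsonMoeglin2016Balls, §3.5–3.6 (p0011 L18, L79)] -/
theorem xElem_mulVec_inl (a a' : α) (m : β) :
    Matrix.mulVec (xElem (α := α) (β := β) a m) (Pi.single (Sum.inl a') 1) = 0 := by
  ext i
  rcases i with i | i <;>
    simp [xElem_eq_single, Matrix.mulVec, dotProduct, Matrix.single_apply, Pi.single_apply]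

/-! ## §1.5 The tautological chart of the space of negative `q`-planes at `V_-` (§6.3) -/

variable (α β)

/-- **Tautological chart (differential at the base point)**: `X ↦ X₁₂ ∈ Hom(V_-, V_+) = M_{p×q}(ℂ)`, the `V_+`-component of `X|_{V_-}`
(`tautChart_mulVec`).  «`X = U(p,q)/(U(p) × U(q))` of negative `q`-planes … isomorphic to a bounded symmetric domain in `ℂ^{pq}`»: near the base
point `V_-` the `q`-planes are the graphs of `T ∈ Hom(V_-, V_+)`, and a tangent vector `X ∈ 𝔭₀` moves `V_-` to the graph of `t·X₁₂ + O(t²)`.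
DEFINED (`ℂ`-linear). [cite: BergeronMillsonMoeglin2016Balls, §6.3 (arXiv Part 2 §1.3, p0030 L10–L12, L19)] -/
def tautChart : Matrix (α ⊕ β) (α ⊕ β) ℂ →ₗ[ℂ] Matrix α β ℂ where
  toFun X := X.toBlocks₁₂
  map_add' X Y := by ext i j; rfl
  map_smul' c X := by ext i j; rfl

/-- The CONJUGATE chart `X ↦ X₂₁ ∈ Hom(V_+, V_-)` (on `𝔭₀ = {(0 B; B^* 0)}` this is `B ↦ B^*`, conjugate-linear in the tautological coordinate).
DEFINED. [cite: BergeronMillsonMoeglin2016Balls, §3.4 (p0011 L1–L2), §3.6 (p0011 L95)] -/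
def conjChart : Matrix (α ⊕ β) (α ⊕ β) ℂ →ₗ[ℂ] Matrix β α ℂ where
  toFun X := X.toBlocks₂₁
  map_add' X Y := by ext i j; rfl
  map_smul' c X := by ext i j; rfl

variable {α β}

omit [Fintype α] [DecidableEq α] [Fintype β] [DecidableEq β] in
/-- Unfolding. [cite: BergeronMillsonMoeglin2016Balls, §6.3 (p0030 L10–L12)] -/
@[simp] theorem tautChart_fromBlocks (A : Matrix α α ℂ) (B : Matrix α β ℂ) (C : Matrix β α ℂ) (D : Matrix β β ℂ) :
    tautChart α β (Matrix.fromBlocks A B C D) = B :=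
  Matrix.toBlocks_fromBlocks₁₂ A B C D

omit [Fintype α] [DecidableEq α] [Fintype β] [DecidableEq β] in
/-- Unfolding. [cite: BergeronMillsonMoeglin2016Balls, §3.6 (p0011 L95)] -/
@[simp] theorem conjChart_fromBlocks (A : Matrix α α ℂ) (B : Matrix α β ℂ) (C : Matrix β α ℂ) (D : Matrix β β ℂ) :
    conjChart α β (Matrix.fromBlocks A B C D) = C :=
  Matrix.toBlocks_fromBlocks₂₁ A B C D

omit [DecidableEq α] [DecidableEq β] in
/-- **The chart is tautological**: for `w ∈ V_-`, the `V_+`-component of `X·w` is `(tautChart X) w`.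
[cite: BergeronMillsonMoeglin2016Balls, §6.3 (p0030 L10–L12, L19)] -/
theorem tautChart_mulVec (X : Matrix (α ⊕ β) (α ⊕ β) ℂ) (w : β → ℂ) :
    (fun a => Matrix.mulVec X (Sum.elim 0 w) (Sum.inl a)) = Matrix.mulVec (tautChart α β X) w := by
  obtain ⟨A, B, C, D, rfl⟩ := exists_eq_fromBlocks X
  funext a
  simp [Matrix.fromBlocks_mulVec]

/-- **In the tautological chart `J_𝔭 = Ad(a(ζ))` is multiplication by `+i`** — [BMM16]'s holomorphic tangent space `𝔭′` (`(1,0)`) is the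
TAUTOLOGICAL `T^{1,0}` of the space of negative `q`-planes. [cite: BergeronMillsonMoeglin2016Balls, §1.5 (p0004 L56–L59), §3.5 (p0011 L61), §6.3 (p0030 L10–L12)] -/
theorem tautChart_Jp (X : Matrix (α ⊕ β) (α ⊕ β) ℂ) : tautChart α β (Jp α β X) = Complex.I • tautChart α β X := by
  obtain ⟨A, B, C, D, rfl⟩ := exists_eq_fromBlocks X
  rw [Jp_fromBlocks, tautChart_fromBlocks, tautChart_fromBlocks]

/-- … while the conjugate chart sees `−i`. [cite: BergeronMillsonMoeglin2016Balls, §3.6 (p0011 L80, L95)] -/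
theorem conjChart_Jp (X : Matrix (α ⊕ β) (α ⊕ β) ℂ) : conjChart α β (Jp α β X) = (-Complex.I) • conjChart α β X := by
  obtain ⟨A, B, C, D, rfl⟩ := exists_eq_fromBlocks X
  rw [Jp_fromBlocks, conjChart_fromBlocks, conjChart_fromBlocks]

/-! ## §1.6 Weights of the diagonal torus on `𝔭′`, `𝔭″` (§3.7; the highest weights of §3.11–3.13 in degree one) -/

/-- **«The roots of `𝔱` occuring in `𝔭′` are the linear forms `t_α − t_μ`»**: `ad(diag t) x_{α,μ} = (t_α − t_μ) x_{α,μ}`.  At `(p, q) = (n−1, 1)`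
the highest of these weights, that of `x_{1,n}`, is `t₁ − t_n` = the weight `(1,0,…,0; −1)` = «`(q,…,q (b), 0,…,0; −b,…,−b (q))`» at
`q = b = 1`: the `K`-type `V(1×1, 0) = 𝔭′` of type `(1,0)`. [cite: BergeronMillsonMoeglin2016Balls, §3.7 (p0012 L35–L37), §3.11 (p0013 L69–L71)] -/
theorem ad_diagonal_xElem (t : α ⊕ β → ℂ) (a : α) (m : β) :
    Matrix.diagonal t * xElem (α := α) (β := β) a m - xElem a m * Matrix.diagonal t =
      (t (Sum.inl a) - t (Sum.inr m)) • xElem (α := α) (β := β) a m := by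
  ext i j
  simp only [Matrix.sub_apply, Matrix.diagonal_mul, Matrix.mul_diagonal, Matrix.smul_apply, xElem_eq_single,
    Matrix.single_apply, smul_eq_mul]
  split_ifs with h
  · obtain ⟨rfl, rfl⟩ := h
    ring
  · ring

/-- `ad(diag t) y_{α,μ} = (t_μ − t_α) y_{α,μ}`; at `(p, q) = (n−1, 1)` the highest weight on `𝔭″` is `t_n − t_{n−1}` = «`(0,…,0, −q,…,−q (a); a,…,a (q))`»
at `q = a = 1`, i.e. `(0,…,0,−1; 1)`: the `K`-type `V(0, 1×1) = 𝔭″` of type `(0,1)`.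
[cite: BergeronMillsonMoeglin2016Balls, §3.7 (p0012 L35–L37), §3.12 (p0014 L2–L4)] -/
theorem ad_diagonal_yElem (t : α ⊕ β → ℂ) (a : α) (m : β) :
    Matrix.diagonal t * yElem (α := α) (β := β) a m - yElem a m * Matrix.diagonal t =
      (t (Sum.inr m) - t (Sum.inl a)) • yElem (α := α) (β := β) a m := by
  ext i j
  simp only [Matrix.sub_apply, Matrix.diagonal_mul, Matrix.mul_diagonal, Matrix.smul_apply, yElem_eq_single,
    Matrix.single_apply, smul_eq_mul]
  split_ifs with h
  · obtain ⟨rfl, rfl⟩ := h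
    ring
  · ring

/-! ## §1.7 THE HODGE-TYPE LABEL in degree one: type `(a, b)` (`a + b = 1`) -/

variable (α β)

/-- **BMM's Hodge-type label in degree one.**  «`Q_{b,0}` … related to the cohomology of type `(bq, 0)`», «`𝔲_{b,0} ∩ 𝔭 ≅ E_b ⊗ V_-^* ⊂ 𝔭′`»,
«`e(bq,0) ∈ ∧^{bq,0}(𝔭) ≅ ∧^{bq}(𝔭′)`», «`e(0,aq) ∈ ∧^{0,aq}(𝔭) = ∧^{aq}(𝔭″)`», «`e(bq,aq) ∈ ∧^{bq,aq}𝔭 ≅ (∧^{bq}𝔭′) ⊗ (∧^{aq}𝔭″)`»: the type-`(a, b)`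
part of `∧^{a+b}𝔭` is `∧^a 𝔭′ ⊗ ∧^b 𝔭″`, `𝔭′`/`𝔭″` the `±i`-eigenspaces of `J_𝔭` (§1.5; Borel–Wallach II 4.1–4.2 `C^{p,q} = Hom_K(Λ^p𝔭⁺ ⊗ Λ^q𝔭⁻, V)`).
DEFINED in degree one (the only degree [Liu2021] App. D uses): the type-`(a, b)` summand of `∧¹𝔭 = 𝔭` is the `i^a (−i)^b`-eigenspace of
`J_𝔭` in `𝔭` (meaningful for `a + b = 1`). [cite: BergeronMillsonMoeglin2016Balls, §1.5 (p0004 L56–L60), §3.11–3.13 (p0013 L24, L39, L55, L88–L91; p0014 L41–L44)]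
[cite: BorelWallach2000, II §4.1–4.2] -/
def typeSummand (a b : ℕ) : Submodule ℂ (Matrix (α ⊕ β) (α ⊕ β) ℂ) :=
  pSub α β ⊓ Module.End.eigenspace (Jp α β) (Complex.I ^ a * (-Complex.I) ^ b)

variable {α β}

/-- Unfolding of the label. [cite: BergeronMillsonMoeglin2016Balls, §1.5 (p0004 L56–L57)] -/
theorem mem_typeSummand_iff {a b : ℕ} {X : Matrix (α ⊕ β) (α ⊕ β) ℂ} :
    X ∈ typeSummand α β a b ↔ X ∈ pSub α β ∧ Jp α β X = (Complex.I ^ a * (-Complex.I) ^ b) • X := by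
  rw [typeSummand, Submodule.mem_inf, Module.End.mem_eigenspace_iff]

/-- **THE HINGE: type `(1,0)` in degree one IS `𝔭′ = V_+ ⊗ V_-^* = Hom(V_-, V_+)`** (the upper-right block, the tautological holomorphic tangent
space). [cite: BergeronMillsonMoeglin2016Balls, §1.5 (p0004 L56–L59), §3.6 (p0011 L79, L83–L86), §3.11 (p0013 L24, L39, L55)] -/
theorem typeSummand_one_zero : typeSummand α β 1 0 = pPrime α β := by
  ext X
  rw [mem_typeSummand_iff, mem_pPrime_iff_Jp, pow_one, pow_zero, mul_one]

/-- **Type `(0,1)` in degree one IS `𝔭″ = V_- ⊗ V_+^* = Hom(V_+, V_-)`** (the lower-left block).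
[cite: BergeronMillsonMoeglin2016Balls, §3.6 (p0011 L80, L88–L91), §3.12 (p0013 L88–L91)] -/
theorem typeSummand_zero_one : typeSummand α β 0 1 = pDoublePrime α β := by
  ext X
  rw [mem_typeSummand_iff, mem_pDoublePrime_iff_Jp, pow_zero, pow_one, one_mul]

/-! ## §1.8 [Liu2021] App. D: the archimedean identities behind «Hodge type `(1,0)` ⟹ `μ̃_{τ₁}(z) = 1/z` ⟹ `μ̃ = μ|·|_E^{−1/2}`» -/

/-- **[Liu2021, proof of Thm. D.6 (1), the `(1,0)` case]**: with `μ` of weight one, «`μ_{τ}(z) = arg(z)^{−𝔴_τ}`» via `τ' ∈ Φ_μ` (`𝔴 = 1`,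
`arg(z) = z/|z|`) and «`μ^{alg} = μ·|·|_E^{−1/2}`» (`|z|_E = |z|²` at the complex place, so the factor is `|z|⁻¹`): `arg(z)⁻¹ · |z|⁻¹ = 1/z` —
«we have `μ̃_{τ₁}(z) = 1/z`, where we have identified `ℂ` with `E ⊗_{τ₁} ℝ` through the embedding `τ'₁`, which implies that `μ̃ = μ|·|_E^{−1/2}`».
[cite: Liu2021, §4.1 (FJcycle.tex l. 1908–1912, l. 1926), App. D proof of Thm. D.6 (1) (l. 5628)] -/
theorem liu_arch_oneZero (z : ℂ) (hz : z ≠ 0) : (z / (‖z‖ : ℂ))⁻¹ * ((‖z‖ : ℂ))⁻¹ = z⁻¹ := by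
  have hr : ((‖z‖ : ℝ) : ℂ) ≠ 0 := Complex.ofReal_ne_zero.mpr (norm_ne_zero_iff.mpr hz)
  rw [div_eq_mul_inv, mul_inv, inv_inv, mul_assoc, mul_inv_cancel₀ hr, mul_one]

/-- **[Liu2021, proof of Thm. D.6 (1), the `(0,1)` case]**: for `μ^c` (`c` = complex conjugation at `τ₁` through `τ'₁`),
`arg(z̄)⁻¹ · |z|⁻¹ = 1/z̄` — «we have `μ̃_{τ₁}(z) = 1/z̄`, which implies that `μ̃ = μ^c χ̌ |·|_E^{−1/2}`».
[cite: Liu2021, §4.1 (l. 1908–1912, l. 1926), App. D proof of Thm. D.6 (1) (l. 5630)] -/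
theorem liu_arch_zeroOne (z : ℂ) (hz : z ≠ 0) : (star z / (‖z‖ : ℂ))⁻¹ * ((‖z‖ : ℂ))⁻¹ = (star z)⁻¹ := by
  have hr : ((‖z‖ : ℝ) : ℂ) ≠ 0 := Complex.ofReal_ne_zero.mpr (norm_ne_zero_iff.mpr hz)
  rw [div_eq_mul_inv, mul_inv, inv_inv, mul_assoc, mul_inv_cancel₀ hr, mul_one]

/-- **[Liu2021] the sign chain `(1,0)` ↔ `ω^{−1,−,0}` ↔ `Im τ'(e) < 0`**: proof of Prop. 4.13, l. 2140 «`π_{∞1} ≃ ω^{m_1,±,1}_{n−1,1}` … the sign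
in the parameter is the sign of `i^{−1}τ_i^+(e)`»; Lem. D.2 (2), l. 5284 «only `ω^{−1,−,0}_{n−1,1}` … is isomorphic to `π^{1,0}_{n−1,1}`»; Def. 4.12,
l. 2107 «`τ'(e)` has negative imaginary part for every `τ' ∈ Φ_μ`» (tree: `Literature.AlgebraicGeometry.Liu2021.IsAdmissibleElement`).  The
arithmetic linking the sign `−` of `i^{−1}τ'(e)` to Def. 4.12: `Re(i⁻¹ w) = Im w`, so `i⁻¹τ'(e) < 0 ⟺ Im τ'(e) < 0` for `τ'(e) ∈ iℝ`.
[cite: Liu2021, Prop. 4.13 proof (FJcycle.tex l. 2140), Def. 4.12 (l. 2102–2108), Lem. D.2 (2) (l. 5284)] -/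
theorem liu_weilSign_re (w : ℂ) : (Complex.I⁻¹ * w).re = w.im := by
  simp [Complex.inv_I, Complex.mul_re]

/-! ## §1.9 [HarrisKudlaSweet1996] (1.15)/(1.31): on the Siegel Levi the splitting character is `χ_V(det g)` -/

/-- **[HKS96, Lemma 1.3 / (1.31)] «Thus `j(i(Δ(g))) = 0` and `x(g) = det(g)`. Thus `β_{V,χ}(i(Δ(g))) = χ_V(det(g))`»** for the (1.15)-shaped
character `β(g) = χ(x(g)) γ^{−j(g)}` of the tree (`HKSSplittingDatum.betaOf`): whenever `j(g) = 0` and `x(g) = d` (= `det g` on the Levi),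
`β(g) = χ(d)` — `χ` ITSELF at the determinant, no conjugate, no inverse.
[cite: HarrisKudlaSweet1996, (1.14)–(1.15) p. 952, Lemma 1.3 (1.31) p. 954–955] -/
theorem hks_betaOf_of_j_eq_zero {G Eu : Type*} [CommGroup Eu] (χ : Eu →* ℂˣ) (γ : ℂˣ) (x : G → Eu) (j : G → ℤ)
    (g : G) (d : Eu) (hj : j g = 0) (hx : x g = d) :
    HarrisKudlaSweet1996.HKSSplittingDatum.betaOf χ γ x j g = χ d := by
  rw [HarrisKudlaSweet1996.HKSSplittingDatum.betaOf, hj, hx, neg_zero, zpow_zero, mul_one]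

end HodgeTypeSign

/-! ## §2 The packaged convention `D_BMM` -/

open HodgeTypeSign NumberField

/-- **The [BMM16] Hodge-type sign convention, one clause per printed sentence** (blocks of sizes `p = |V_+|`, `q = |V_-|`, i.e. index types
`Fin p`, `Fin q`; [Liu2021] App. D uses `(p, q) = (n−1, 1)`).  Every field is a definitional unfolding or a finite identity of §1 and is
PROVED in `hodgeTypeSignConvention_holds`; the docstring of each field is the printed sentence it transcribes, with its locator
(`pNNNN Lk` = chunk:line of the held arXiv text of [BergeronMillsonMoeglin2016Balls]; `l. NNNN` = line of [Liu2021]'s `FJcycle.tex`).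
[Liu2021, Def. 4.5 (2)] (the `Lie_E(A_μ)` bullet = the Hodge type of the CM datum, the CM-character bullet, the polarisation bullet,
l. 1946–1955) is the tree's `Literature.NumberTheory.Automorphic.Liu2021.Def45.CMDatum` (`det45`, `isCMCharacter`, `polDR`); the field
`liu_def45_lie` re-exports its REAL `Lie` bullet and names the two ⟨CARRIER⟩ bullets, nothing of Def. 4.5 is re-vendored; the summit-side T-SIGN theorems (`Summit.HodgeConjecture.CorCM.D2Bridge.TSign.cmType_eq_lineType_of_isAdmissibleElement`
et al., `OmegaPinTSign.lean` `678a3688b50b1251`) are cited by name in the module docstring only.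
[cite: BergeronMillsonMoeglin2016Balls, §1.5, §3.3–3.7, §3.11–3.13, §6.3] [cite: Liu2021, §4.1, App. D l. 5265–5276, l. 5628–5630]
[cite: HarrisKudlaSweet1996, (1.15) p. 952, (1.31) p. 955] -/
structure HodgeTypeSignConvention : Prop where
  /-- [BMM16 §3.5, p0011 L50] «Let `ζ = e^{iπ/4}`. Then `ζ` satisfies `ζ² = i`.» -/
  bmm_zeta_sq : zeta ^ 2 = Complex.I
  /-- [BMM16 §3.5, p0011 L50–L62] «Let `a(ζ)` be the diagonal `m` by `m` block matrix given by `a(ζ) = (ζ 0; 0 ζ⁻¹)` … the adjoint action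
  `Ad(a(ζ))` of on `𝔭` induces the required almost complex structure, that is we have `J_𝔭 = Ad(a(ζ))`.» -/
  bmm_J_eq_Ad : ∀ (p q : ℕ) (X : Matrix (Fin p ⊕ Fin q) (Fin p ⊕ Fin q) ℂ),
    aZeta (Fin p) (Fin q) = Matrix.fromBlocks (zeta • 1) 0 0 (zeta⁻¹ • 1) ∧
      Jp (Fin p) (Fin q) X = aZeta (Fin p) (Fin q) * X * (aZeta (Fin p) (Fin q))⁻¹
  /-- [BMM16 §3.5, p0011 L67] «`a(ζ) v_α = ζ v_α`, `a(ζ) v_μ = ζ⁻¹ v_μ`» (`v_α ∈ V_+`, `v_μ ∈ V_-`). -/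
  bmm_aZeta_basis : ∀ (p q : ℕ) (a : Fin p) (m : Fin q),
    Matrix.mulVec (aZeta (Fin p) (Fin q)) (Pi.single (Sum.inl a) 1) = zeta • Pi.single (Sum.inl a) 1 ∧
      Matrix.mulVec (aZeta (Fin p) (Fin q)) (Pi.single (Sum.inr m) 1) = zeta⁻¹ • Pi.single (Sum.inr m) 1
  /-- [BMM16 §3.4, p0010 L84] «`(v_α, v_β) = δ_{α,β}` and `(v_μ, v_ν) = −δ_{μ,ν}`»; [§3.5, p0011 L17–L19] «`(v₁ ⊗ v₂^*)(v) = (v, v₂) v₁`». -/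
  bmm_form_and_tensor : ∀ (p q : ℕ),
    (∀ a a' : Fin p, herm (α := Fin p) (β := Fin q) (Pi.single (Sum.inl a) 1) (Pi.single (Sum.inl a') 1) = if a = a' then 1 else 0) ∧
    (∀ m m' : Fin q, herm (α := Fin p) (β := Fin q) (Pi.single (Sum.inr m) 1) (Pi.single (Sum.inr m') 1) = if m = m' then -1 else 0) ∧
    (∀ v₁ v₂ v : Fin p ⊕ Fin q → ℂ, Matrix.mulVec (tensorStar v₁ v₂) v = herm (α := Fin p) (β := Fin q) v v₂ • v₁)
  /-- [BMM16 §3.6, p0011 L79] «`x_{α,μ} = −v_α ⊗ v_μ^* = (0 1; 0 0)` whence `J_𝔭 x_{α,μ} = i x_{α,μ}`». -/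
  bmm_x : ∀ (p q : ℕ) (a : Fin p) (m : Fin q),
    xElem (α := Fin p) (β := Fin q) a m = -tensorStar (Pi.single (Sum.inl a) 1) (Pi.single (Sum.inr m) 1) ∧
      xElem (α := Fin p) (β := Fin q) a m = Matrix.single (Sum.inl a) (Sum.inr m) 1 ∧
        Jp (Fin p) (Fin q) (xElem a m) = Complex.I • xElem a m
  /-- [BMM16 §3.6, p0011 L80] «`y_{α,μ} = σ₀(x_{α,μ}) = v_μ ⊗ v_α^* = (0 0; 1 0)` whence `J_𝔭 y_{α,μ} = −i y_{α,μ}`». -/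
  bmm_y : ∀ (p q : ℕ) (a : Fin p) (m : Fin q),
    yElem (α := Fin p) (β := Fin q) a m = tensorStar (Pi.single (Sum.inr m) 1) (Pi.single (Sum.inl a) 1) ∧
      yElem (α := Fin p) (β := Fin q) a m = Matrix.single (Sum.inr m) (Sum.inl a) 1 ∧
        Jp (Fin p) (Fin q) (yElem a m) = (-Complex.I) • yElem a m
  /-- [BMM16 §3.6, p0011 L83–L91, L101] «The set `{x_{α,μ} : 1 ≤ α ≤ p, p+1 ≤ μ ≤ p+q}` is a basis for `𝔭′`. In the corresponding matrix realization
  we have `𝔭′ = V_+ ⊗ V_-^* = {(0 B; 0 0) : B ∈ M_{p×q}(ℂ)}`.  Similarly … `𝔭″ = V_- ⊗ V_+^* = {(0 0; C 0) : C ∈ M_{q×p}(ℂ)}` … the above splitting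
  into `B, C` blocks corresponds to the splitting `𝔭 = 𝔭′ + 𝔭″`.» -/
  bmm_pPrime_matrices : ∀ (p q : ℕ),
    pPrime (Fin p) (Fin q) = Submodule.span ℂ (Set.range fun am : Fin p × Fin q => xElem (α := Fin p) (β := Fin q) am.1 am.2) ∧
    (∀ X, X ∈ pPrime (Fin p) (Fin q) ↔ X.toBlocks₁₁ = 0 ∧ X.toBlocks₂₁ = 0 ∧ X.toBlocks₂₂ = 0) ∧
    (∀ X, X ∈ pDoublePrime (Fin p) (Fin q) ↔ X.toBlocks₁₁ = 0 ∧ X.toBlocks₁₂ = 0 ∧ X.toBlocks₂₂ = 0) ∧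
    pPrime (Fin p) (Fin q) ⊔ pDoublePrime (Fin p) (Fin q) = pSub (Fin p) (Fin q) ∧
    pPrime (Fin p) (Fin q) ⊓ pDoublePrime (Fin p) (Fin q) = ⊥
  /-- [BMM16 §1.5, p0004 L56–L59] «Thus `𝔭′ = {X ∈ 𝔭 : Ad(c) X = iX}` (where `𝔭` is the complexification of `𝔭₀`) is the holomorphic tangent space.
  As a representation of `GL(p,ℂ) × GL(q,ℂ)` the space `𝔭′` is isomorphic to `V_+ ⊗ V_-^*`» — with `c = a(ζ)` (§3.5): `𝔭′` is the `+i`-eigenspace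
  of `J_𝔭` in `𝔭`, `𝔭″` the `−i`-eigenspace; `x_{α,μ} : v_μ ↦ v_α` and kills `V_+` (`𝔭′ = Hom(V_-, V_+)`), and `Ad` of the block-diagonal group acts
  on `(0 B; 0 0)` by `B ↦ g B h′`. -/
  bmm_holomorphic_tangent : ∀ (p q : ℕ),
    (∀ X, X ∈ pPrime (Fin p) (Fin q) ↔ X ∈ pSub (Fin p) (Fin q) ∧ Jp (Fin p) (Fin q) X = Complex.I • X) ∧
    (∀ X, X ∈ pDoublePrime (Fin p) (Fin q) ↔ X ∈ pSub (Fin p) (Fin q) ∧ Jp (Fin p) (Fin q) X = (-Complex.I) • X) ∧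
    (∀ (a : Fin p) (m : Fin q), Matrix.mulVec (xElem (α := Fin p) (β := Fin q) a m) (Pi.single (Sum.inr m) 1) = Pi.single (Sum.inl a) 1) ∧
    (∀ (a a' : Fin p) (m : Fin q), Matrix.mulVec (xElem (α := Fin p) (β := Fin q) a m) (Pi.single (Sum.inl a') 1) = 0) ∧
    (∀ (g g' : Matrix (Fin p) (Fin p) ℂ) (h h' : Matrix (Fin q) (Fin q) ℂ) (B : Matrix (Fin p) (Fin q) ℂ),
      Matrix.fromBlocks g 0 0 h * Matrix.fromBlocks 0 B 0 0 * Matrix.fromBlocks g' 0 0 h' = Matrix.fromBlocks 0 (g * B * h') 0 0)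
  /-- [BMM16 §6.3 = arXiv Pt 2 §1.3, p0030 L10–L12, L19] «`X = U(p,q)/(U(p) × U(q))` of negative `q`-planes in `V_{τ₁}`. It is isomorphic to a bounded
  symmetric domain in `ℂ^{pq}`», base point = the negative `q`-plane `V_-`: in the TAUTOLOGICAL chart `T_{V_-} = Hom(V_-, V_+)` (the `V_+`-component of
  `X|_{V_-}`) `J_𝔭` is multiplication by `+i`; the conjugate chart `Hom(V_+, V_-)` sees `−i`.  (The WORLD-C bit: [BMM16]'s `(1,0)` is
  tautological-holomorphic.) -/
  bmm_tautological : ∀ (p q : ℕ) (X : Matrix (Fin p ⊕ Fin q) (Fin p ⊕ Fin q) ℂ) (w : Fin q → ℂ),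
    (fun a => Matrix.mulVec X (Sum.elim 0 w) (Sum.inl a)) = Matrix.mulVec (tautChart (Fin p) (Fin q) X) w ∧
      tautChart (Fin p) (Fin q) (Jp (Fin p) (Fin q) X) = Complex.I • tautChart (Fin p) (Fin q) X ∧
        conjChart (Fin p) (Fin q) (Jp (Fin p) (Fin q) X) = (-Complex.I) • conjChart (Fin p) (Fin q) X
  /-- [BMM16 §3.7, p0012 L35–L37] «We may take `i𝔱₀` as the algebra of diagonal matrices `(t_1, …, t_{p+q})`. The roots of `𝔱` occuring in `𝔭′` are the
  linear forms `t_α − t_μ`»; [§3.11 Remark, p0013 L69–L71] highest weight «`(q,…,q (b), 0,…,0 (p−b); −b,…,−b (q))`» of `V(b×q) ⊂ ∧^{bq,0}𝔭`, [§3.12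
  Remark, p0014 L2–L4] «`(0,…,0 (p−a), −q,…,−q (a); a,…,a (q))`» of `V(0, a×q) ⊂ ∧^{0,aq}𝔭` — in degree one (`q = 1`, `a + b = 1`): `(1,0,…,0;−1)` on
  `𝔭′` and `(0,…,0,−1;1)` on `𝔭″`. -/
  bmm_torus_weights : ∀ (p q : ℕ) (t : Fin p ⊕ Fin q → ℂ) (a : Fin p) (m : Fin q),
    Matrix.diagonal t * xElem (α := Fin p) (β := Fin q) a m - xElem a m * Matrix.diagonal t =
        (t (Sum.inl a) - t (Sum.inr m)) • xElem (α := Fin p) (β := Fin q) a m ∧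
      Matrix.diagonal t * yElem (α := Fin p) (β := Fin q) a m - yElem a m * Matrix.diagonal t =
        (t (Sum.inr m) - t (Sum.inl a)) • yElem (α := Fin p) (β := Fin q) a m
  /-- [BMM16 §3.11–3.13, p0013 L24, L39, L55, L88–L91; p0014 L41–L44] «the theta-stable parabolics `Q_{b,0}` which will be related to the cohomology of
  type `(bq, 0)`», «`𝔲_{b,0} ∩ 𝔭 ≅ E_b ⊗ V_-^* ⊂ 𝔭′`», «`e(bq,0) ∈ ∧^{bq,0}(𝔭) ≅ ∧^{bq}(𝔭′)`», «`𝔲_{0,a} ∩ 𝔭 ≅ V_- ⊗ F_a^* ⊂ 𝔭″`»,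
  «`e(0,aq) ∈ ∧^{0,aq}(𝔭) = ∧^{aq}(𝔭″)`», «`e(bq,aq) ∈ ∧^{bq,aq}𝔭 ≅ (∧^{bq}𝔭′) ⊗ (∧^{aq}𝔭″)`»; [§5.2.1 Remark, p0022 L97–L98] «the Hodge degrees of
  the special cocycles we will construct will be of the form `(bq, aq)`»; [§5.7, p0027 L47–L48] «`V(bq,aq)` … with highest weight
  `(q,…,q (b), 0,…,0, −q,…,−q (a); a−b,…,a−b (q))`»: IN DEGREE ONE the type-`(1,0)` summand of `∧¹𝔭 = 𝔭` is `𝔭′ = V_+ ⊗ V_-^*` and the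
  type-`(0,1)` summand is `𝔭″ = V_- ⊗ V_+^*`. -/
  bmm_type_label : ∀ (p q : ℕ),
    typeSummand (Fin p) (Fin q) 1 0 = pPrime (Fin p) (Fin q) ∧ typeSummand (Fin p) (Fin q) 0 1 = pDoublePrime (Fin p) (Fin q)
  /-- [Liu2021 App. D, l. 5265–5276] «`U(p,q)_ℝ` … preserving the hermitian form given by the matrix `(I_p 0; 0 −I_q)` … By the computation in [BMM]*{Section 5},
  up to equivalence, there are only two irreducible unitary representations `π` of `U(n−1,1)_ℝ` such that `H¹(𝔲_{n−1,1}, K_{n−1,1}; π) ≠ {0}` … Let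
  us label them by `π^{1,0}_{n−1,1}` and `π^{0,1}_{n−1,1}` in the way that `H¹(…; π^{1,0}_{n−1,1})` and `H¹(…; π^{0,1}_{n−1,1})` have Hodge types `(1, 0)` and
  `(0, 1)`, respectively» — Liu's `(1,0)` IS [BMM16]'s at `(p, q) = (n−1, 1)`: the type-`(1,0)` summand of `𝔭` for `U(n−1,1)` is
  `𝔭′ = Hom(V_-, V_+) ≅ M_{(n−1)×1}(ℂ)` (the `K`-type of `π^{1,0}`; Lem. D.2 (2), l. 5284: `π^{1,0} ≅ ω^{−1,−,0}_{n−1,1}` — cited only). -/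
  liu_label : ∀ n : ℕ, 2 ≤ n →
    typeSummand (Fin (n - 1)) (Fin 1) 1 0 = pPrime (Fin (n - 1)) (Fin 1) ∧
      typeSummand (Fin (n - 1)) (Fin 1) 0 1 = pDoublePrime (Fin (n - 1)) (Fin 1)
  /-- [Liu2021 §4.1 l. 1908–1912, l. 1926; App. D proof of Thm. D.6 (1), l. 5628–5630] «`μ_τ` … is the character `z ↦ arg(z)^{−𝔴_τ}` … via the unique
  element `τ' ∈ Φ_μ` above `τ`», «`μ^{alg} := μ·|·|_E^{−1/2}`», «If … `H¹_B(X, ℂ)[π^∞]` has Hodge type `(1, 0)` … we have `μ̃_{τ₁}(z) = 1/z` … through the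
  embedding `τ'₁`, which implies that `μ̃ = μ|·|_E^{−1/2}`.  If … Hodge type `(0, 1)` … `μ̃_{τ₁}(z) = 1/z̄`, which implies that `μ̃ = μ^c χ̌ |·|_E^{−1/2}`»:
  `arg(z)⁻¹·|z|⁻¹ = 1/z` and `arg(z̄)⁻¹·|z|⁻¹ = 1/z̄`. -/
  liu_archimedean : ∀ z : ℂ, z ≠ 0 →
    (z / (‖z‖ : ℂ))⁻¹ * ((‖z‖ : ℂ))⁻¹ = z⁻¹ ∧ (star z / (‖z‖ : ℂ))⁻¹ * ((‖z‖ : ℂ))⁻¹ = (star z)⁻¹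
  /-- [Liu2021 Prop. 4.13 proof l. 2140; Lem. D.2 (2) l. 5284; Def. 4.12 l. 2107] «`π_{∞1} ≃ ω^{m_1,±,1}_{n−1,1}` … the sign in the parameter is the
  sign of `i^{−1}τ_i^+(e)`», «only `ω^{−1,−,0}_{n−1,1}` (resp. `ω^{1,+,0}_{n−1,1}`) is isomorphic to `π^{1,0}_{n−1,1}` (resp. `π^{0,1}_{n−1,1}`)», «`τ'(e)` has
  negative imaginary part for every `τ' ∈ Φ_μ`»: type `(1,0)` ↔ sign `−` ↔ `i⁻¹τ'(e) < 0` ↔ `Im τ'(e) < 0` (= `μ`-admissibility, Def. 4.12) — the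
  arithmetic `Re(i⁻¹w) = Im w`. -/
  liu_weil_sign : ∀ w : ℂ, (Complex.I⁻¹ * w).re = w.im
  /-- [Liu2021 Def. 4.5 (2), l. 1944–1955] «`D_μ = (A_μ, i_μ, λ_μ, r_μ)` … • `i_μ : M_μ → End_E(A_μ)_ℚ` is a CM structure such that – for every `x ∈ M_μ`,
  the determinant of the action of `i_μ(x)` on the `E`-vector space `Lie_E(A_μ)` equals `η_μ(x)`» (the Hodge type of the CM datum: which CM type
  `A_μ` carries) «– the associated CM character of `A_μ` … coincides with `μ^{alg}`, • `λ_μ : A_μ → A_μ^∨` is a polarization satisfying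
  `λ ∘ i_μ(x) = i_μ(x̄)^∨ ∘ λ`» — the TREE's transcription `Literature.NumberTheory.Automorphic.Liu2021.Def45.CMDatum` (the `Lie` bullet is its REAL
  field `det45`, read on the cotangent space `𝔪_e/𝔪_e² = Lie_E(A_μ)^∨`; the CM-character and polarisation bullets are its ⟨CARRIER⟩ fields
  `isCMCharacter`, `polDR`), re-exported at an integral element: `i_μ(x) = 1 ⊗ f ⟹ det(f^* | 𝔪_e/𝔪_e²) = η_μ(x)`. -/
  liu_def45_lie : ∀ {E : Type} [Field E] [NumberField E] [IsCMField E] {L : Type} [Field L] [NumberField L] [IsGalois ℚ L]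
      (φ : E →ₐ[ℚ] L) (ι : L →+* ℂ) {μ : Literature.NumberTheory.Automorphic.IdeleClassGroup E →ₜ* Circle}
      (hμ : Literature.NumberTheory.Automorphic.IdeleClassGroup.IsConjugateSymplectic E μ)
      (hw : Literature.NumberTheory.Automorphic.IdeleClassGroup.HasWeight E μ 1)
      (C : Literature.NumberTheory.Automorphic.Liu2021.Def45.Carriers E μ)
      (D : Literature.NumberTheory.Automorphic.Liu2021.Def45.CMDatum φ ι hμ hw C)
      (x : Literature.NumberTheory.Automorphic.IdeleClassGroup.muAlgValueField E μ) (f : CategoryTheory.End D.A),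
      D.i x = Literature.AlgebraicGeometry.Motives.AbelianVariety.endAlgebra.of D.A f →
        LinearMap.det (Literature.AlgebraicGeometry.Motives.AbelianVariety.cotangentMap D.A f) =
          Literature.NumberTheory.Automorphic.Liu2021.Def45.eta φ ι hμ x
  /-- [HKS96 (1.14)–(1.15) p. 952; Lemma 1.3 (1.31) p. 954–955] «`β_{V,χ}(g) = χ_V(x(g)) γ_F(η∘R_V)^{−j(g)}`», «`j(i(Δ(g))) = 0` and `x(g) = det(g)`.
  Thus `β_{V,χ}(i(Δ(g))) = χ_V(det(g))`» — the «`χ(det a)`» token: on the Siegel Levi the splitting character is `χ_V` itself at the determinant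
  (no bar, no inverse), for the tree's (1.15) `HKSSplittingDatum.betaOf`. -/
  hks_chi_det : ∀ {G Eu : Type} [CommGroup Eu] (χ : Eu →* ℂˣ) (γ : ℂˣ) (x : G → Eu) (j : G → ℤ) (g : G) (d : Eu),
    j g = 0 → x g = d → HarrisKudlaSweet1996.HKSSplittingDatum.betaOf χ γ x j g = χ d

/-- **`D_BMM`** — the [BMM16] Hodge-type sign convention (with its [Liu2021] App. D labelling and the [HKS96] `χ(det)` token) AS ONE `Prop`: the
conjunction of the clauses of `HodgeTypeSignConvention`.  A consumer displays `(hBMM : D_BMM)` next to a row whose reading as a PRINTED instance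
depends on this labelling (e.g. [Liu2021, Thm. 4.18] at the conjugate character); `D_BMM_holds` discharges it.
[cite: BergeronMillsonMoeglin2016Balls, §1.5, §3.3–3.7, §3.11–3.13, §6.3] [cite: Liu2021, App. D l. 5265–5276, l. 5628–5630]
[cite: HarrisKudlaSweet1996, (1.15) p. 952, (1.31) p. 955] -/
def D_BMM : Prop := HodgeTypeSignConvention

/-- `D_BMM` unfolds to the clause structure. [cite: BergeronMillsonMoeglin2016Balls, §3.5–3.6] -/
theorem D_BMM_iff : D_BMM ↔ HodgeTypeSignConvention := Iff.rfl

/-- **Every clause holds** (each is a definitional unfolding or a finite identity of §1). [cite: BergeronMillsonMoeglin2016Balls, §1.5, §3.3–3.7, §3.11–3.13, §6.3]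
[cite: Liu2021, App. D l. 5265–5276, l. 5628–5630] [cite: HarrisKudlaSweet1996, (1.31) p. 955] -/
theorem hodgeTypeSignConvention_holds : HodgeTypeSignConvention where
  bmm_zeta_sq := zeta_sq
  bmm_J_eq_Ad p q X := ⟨rfl, Jp_eq_Ad (Fin p) (Fin q) X⟩
  bmm_aZeta_basis p q a m := ⟨aZeta_mulVec_inl (Fin p) (Fin q) a, aZeta_mulVec_inr (Fin p) (Fin q) m⟩
  bmm_form_and_tensor _ _ := ⟨herm_inl_inl, herm_inr_inr, tensorStar_mulVec⟩
  bmm_x _ _ a m := ⟨xElem_eq_neg_tensorStar a m, xElem_eq_single a m, Jp_xElem a m⟩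
  bmm_y _ _ a m := ⟨yElem_eq_tensorStar a m, yElem_eq_single a m, Jp_yElem a m⟩
  bmm_pPrime_matrices _ _ :=
    ⟨pPrime_eq_span, fun _ => mem_pPrime_iff, fun _ => mem_pDoublePrime_iff, pPrime_sup_pDoublePrime, pPrime_inf_pDoublePrime⟩
  bmm_holomorphic_tangent _ _ :=
    ⟨fun _ => mem_pPrime_iff_Jp, fun _ => mem_pDoublePrime_iff_Jp, xElem_mulVec_inr, xElem_mulVec_inl,
      fun g g' h h' B => conj_ofHom g h h' g' B⟩
  bmm_tautological _ _ X w := ⟨tautChart_mulVec X w, tautChart_Jp X, conjChart_Jp X⟩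
  bmm_torus_weights _ _ t a m := ⟨ad_diagonal_xElem t a m, ad_diagonal_yElem t a m⟩
  bmm_type_label _ _ := ⟨typeSummand_one_zero, typeSummand_zero_one⟩
  liu_label _ _ := ⟨typeSummand_one_zero, typeSummand_zero_one⟩
  liu_archimedean z hz := ⟨liu_arch_oneZero z hz, liu_arch_zeroOne z hz⟩
  liu_weil_sign := liu_weilSign_re
  liu_def45_lie := by
    intro E _ _ _ L _ _ _ φ ι μ hμ hw C D x f h
    exact D.det_cotangentMap_eq_eta h
  hks_chi_det χ γ x j g d hj hx := hks_betaOf_of_j_eq_zero χ γ x j g d hj hx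

/-- **`D_BMM` holds.** [cite: BergeronMillsonMoeglin2016Balls, §1.5, §3.3–3.7, §3.11–3.13, §6.3] -/
theorem D_BMM_holds : D_BMM := hodgeTypeSignConvention_holds

end Literature.RepresentationTheory.BergeronMillsonMoeglin2016

end
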